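import Literature.Probability.RandomPlanarGeometry.SAWTriangularPolygonClasses
import Literature.Probability.RandomPlanarGeometry.SAWWidePolygons
import HarnessLib

/-!
# Madras' polygon join on the triangular lattice: the cap table (S2𝕋), brick frame

Topic `Literature/Probability/RandomPlanarGeometry` (lane «pcv-sawmu», LINE «TRI-MADRAS»: `q_N(𝕋) ≤ A·N^{−1/2}·μ(𝕋)^N`;
continues `SAWTriangularBrickWalks.lean` (`brickGraph`: `ℤ²` with steps `(±2,0)`, `(±1,±1)`), `SAWTriangularPolygonClasses.lean`
(edge sets of brick polygons, `vertsOf`, `shiftEdges`), `SAWWidePolygons.lean` / `SAWPolygonSurgery.lean` (the graph-generic model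
`IsPolygon G E` of a self-avoiding polygon as the edge set of a cycle, `IsPolygon.exists_isPath_erase`, `IsPolygon.exists_two_edges`,
`IsPolygon.merge`) and the `ℤ²` precedent `SAWPolygonJoinCap.lean` (Madras' local rule on `ℤ²`, nine branches).

Source.  N. Madras, J. Stat. Phys. 78 (1995) 681–699 [Madras1995LatticeAnimalsExponent], §2, as recalled by A. Hammond,
arXiv:1504.05286 [Hammond2015SAPJoining], §4.1 p. 18 (arXiv v5): "Madras now defines a modified polygon … formed from `τ` by changing
its structure in a neighbourhood of `Y ∈ ℤ²`.  Depending on the structure of `τ` near `Y`, either two edges are removed and ten edges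
added …, or one edge is removed and nine are added", and "Rotate `σ'` about the vertex `Y` by `π` radians … Form [its modification]
according to the same rules".  There the lattice is `ℤ²`; here the SAME device on the triangular lattice `𝕋` in brick coordinates,
with the lane's OWN local rule (design note `HOME/pub-sawmu-a-p4/g10/DESIGN-tri-cap.md`, machine-verified table): a contact site `t` of
the left polygon `E` comes in three types — A (`t` shared with the right polygon), B (a column pair `t = w + (0,2)`), C (a diagonal pair
`t = w + (−1,1)`); in each type the corridor fact of `SAWTriangularPolygonJoinSlide.lean` (`le_of_isFirstContact`) bounds the sites of
`E` in the rows near `t`, and ONE edge (or a two-edge sub-path) of `E` at the window is replaced by a detour of FOUR more edges through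
sites that the bound certifies to be free, so that the capped polygon carries a north-east edge on a diagonal line `X − Y = d` with
all its window/corridor sites in `{X − Y ≤ d}` — the left side of the junction rhombus of `SAWTriangularPolygonJoinDecode.lean`.

## This file: the three rules at the origin, with their polygon, junction, frontier and decoding properties

* graph-generic kit (verbatim copies of the private lemmas of `SAWPolygonJoinCap.lean`): `polygon_deg_le_two`, `reroute_one`,
  `reroute_two`; reroute bookkeeping `vertsOf_reroute_subset`, `vertsOf_subset_reroute`, `reroute_undo`, `reroute₂_undo`;
* TYPE A (`t = 0` shared; hypothesis `CorrA E`: the sites of `E` in the rows `−2 … 2` have `X ≤ 0`): detours `wA1`, `wA2`, rule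
  `capA`; **`capA_isPolygon_card`** (`#capA E = #E + 4`), **`ne_edges_capA`** (the NE-line `(1,−1)–(2,0)–(3,1)` is in `capA E`),
  `vertsOf_capA_subset` / `vertsOf_subset_capA` / `new_vert_capA` (new sites: rows `−1..1`, `1 ≤ X`, `X − Y ≤ 2`), **`capA_injective`**;
* TYPE B (`t = (0,1)`, partner `(0,−1)`; `CorrB E`: rows `−3 … 1` have `X ≤ 0` and `(0,−1), (−1,0), (−1,−2) ∉ E`): `wB1`, `wB2`,
  `capB`, **`capB_isPolygon_card`**, **`ne_edges_capB`** (NE-line `(0,−1)–(1,0)–(2,1)`), vertex lemmas, **`capB_injective`**;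
* TYPE C (`t = 0`, partner `(1,−1)`; `CorrC E`: rows `−3 … 1` have `X ≤ 1`, `(1,−1) ∉ E` — the intersection of the left-polygon
  facts with the π-rotated right-polygon facts, so one rule serves both sides): six detours `wC1 … wC6` (C5 replaces a two-edge
  sub-path and drops the site `(−1,1)`), rule `capC`, **`capC_isPolygon_card`**, junction site `juncC` (`(1,−1)` or `(3,−1)`) with
  **`ne_edge_capC`**, vertex lemmas (`vertsOf_capC_subset`, `vertsOf_subset_capC`, `new_vert_capC`), the decoder `recoverC` with
  **`recoverC_capC`** and **`capC_injective`**.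
The table (10 detours, every one `+4` edges) and its exhaustive machine check are recorded in the design note; the rules at a
general contact site, the π-rotation for the right polygon, the rhombus merge (`IsPolygon.merge`) and the counting are the sequel
(S4𝕋/S5𝕋).
-/

noncomputable section

open Finset SimpleGraph Literature.Probability.LatticeModels Literature.Probability.Percolation
open Literature.Probability.Percolation.SiteGadgetSystem (vertsOf mem_vertsOf)

namespace Literature.Probability.RandomPlanarGeometry.SAW

namespace TriCap

/-! ### (1) Graph-generic kit (copied from `SAWPolygonJoinCap.lean`, where these are private) -/

section Generic

variable {V : Type*} [DecidableEq V] {G : SimpleGraph V}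

/-- A polygon has at most two edges at any vertex. [folklore] -/
private theorem polygon_deg_le_two {E : Finset (Sym2 V)}
    (hE : IsPolygon G E) {v w₁ w₂ w₃ : V} (h₁ : s(v, w₁) ∈ E) (h₂ : s(v, w₂) ∈ E) (h₃ : s(v, w₃) ∈ E)
    (h12 : w₁ ≠ w₂) (h13 : w₁ ≠ w₃) (h23 : w₂ ≠ w₃) : False := by
  classical
  obtain ⟨u, c, hc, rfl⟩ := hE
  have hv : v ∈ c.support := c.fst_mem_support_of_mem_edges (List.mem_toFinset.1 h₁)
  have hN : (c.toSubgraph.neighborSet v).ncard = 2 := hc.ncard_neighborSet_toSubgraph_eq_two hv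
  have hmem : ∀ {w}, s(v, w) ∈ c.edges.toFinset → w ∈ c.toSubgraph.neighborSet v := fun {w} hw => by
    rw [Subgraph.mem_neighborSet, ← Subgraph.mem_edgeSet, Walk.mem_edges_toSubgraph]
    exact List.mem_toFinset.1 hw
  have hsub : ({w₁, w₂, w₃} : Set V) ⊆ c.toSubgraph.neighborSet v := by
    intro w hw
    simp only [Set.mem_insert_iff, Set.mem_singleton_iff] at hw
    rcases hw with rfl | rfl | rfl
    · exact hmem h₁
    · exact hmem h₂
    · exact hmem h₃
  have hfin : (c.toSubgraph.neighborSet v).Finite := Set.finite_of_ncard_pos (by rw [hN]; norm_num)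
  have h3 : ({w₁, w₂, w₃} : Set V).ncard = 3 := by
    rw [Set.ncard_insert_of_notMem (by simp [h12, h13]) (Set.toFinite _), Set.ncard_pair h23]
  have := Set.ncard_le_ncard hsub hfin
  rw [h3, hN] at this
  omega

/-- **Rerouting one edge.** Replace the edge `uv` of a polygon `E` by a self-avoiding path `A : u ⟶ v` of length `≥ 2` whose interior
vertices avoid the vertices of `E`: the result is a polygon with `#E − 1 + |A|` edges. [folklore] -/
private theorem reroute_one {E : Finset (Sym2 V)} (hE : IsPolygon G E) {u v : V} (huv : s(u, v) ∈ E)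
    {A : G.Walk u v} (hA : A.IsPath) (hlen : 2 ≤ A.length)
    (hint : ∀ x ∈ A.support, x ≠ u → x ≠ v → ∀ e ∈ E, x ∉ e) :
    IsPolygon G (E.erase s(u, v) ∪ A.edges.toFinset) ∧
      (E.erase s(u, v) ∪ A.edges.toFinset).card + 1 = E.card + A.length := by
  have hvu : s(v, u) ∈ E := by rw [Sym2.eq_swap]; exact huv
  obtain ⟨P, hP, hPe, hPvu, hPl, hPs⟩ := hE.exists_isPath_erase hvu
  have hcyc : (A.append P).IsCycle := by
    refine hA.isCycle_append hP ?_ (Or.inl (by omega))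
    intro x hxA hxP
    have hxv : x ≠ v := by
      rintro rfl
      have hnd := hP.support_nodup
      rw [← P.cons_tail_support, List.nodup_cons] at hnd
      exact hnd.1 hxP
    have hxu : x ≠ u := by
      rintro rfl
      have hnd := hA.support_nodup
      rw [← A.cons_tail_support, List.nodup_cons] at hnd
      exact hnd.1 hxA
    have hxE := (hPs x).1 (List.mem_of_mem_tail hxP)
    obtain ⟨e, he, hxe⟩ := hxE
    exact hint x (List.mem_of_mem_tail hxA) hxu hxv e he hxe
  have hedges : (A.append P).edges.toFinset = E.erase s(u, v) ∪ A.edges.toFinset := by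
    rw [Walk.edges_append, List.toFinset_append, hPe, Sym2.eq_swap, Finset.union_comm]
  refine ⟨⟨u, _, hcyc, hedges⟩, ?_⟩
  have hc := List.toFinset_card_of_nodup hcyc.edges_nodup
  rw [Walk.length_edges, Walk.length_append, hedges] at hc
  omega

/-- **Rerouting two consecutive edges.** Replace the sub-path `u – m – v` of a polygon `E` (`m` of degree two:
its only edges are `um`, `mv`) by a self-avoiding path `A : u ⟶ v` of length `≥ 2`, `u ≠ v`, whose interior
vertices avoid the vertices of `E`: the result is a polygon with `#E − 2 + |A|` edges (the site `m` is dropped). [folklore] -/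
private theorem reroute_two {E : Finset (Sym2 V)} (hE : IsPolygon G E) {u m v : V} (hum : s(u, m) ∈ E)
    (hmv : s(m, v) ∈ E) (huv : u ≠ v) (hm : ∀ w, s(m, w) ∈ E → w = u ∨ w = v)
    {A : G.Walk u v} (hA : A.IsPath) (hlen : 2 ≤ A.length)
    (hint : ∀ x ∈ A.support, x ≠ u → x ≠ v → ∀ e ∈ E, x ∉ e) :
    IsPolygon G ((E.erase s(u, m)).erase s(m, v) ∪ A.edges.toFinset) ∧
      ((E.erase s(u, m)).erase s(m, v) ∪ A.edges.toFinset).card + 2 = E.card + A.length := by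
  have hvm : s(v, m) ∈ E := by rw [Sym2.eq_swap]; exact hmv
  have h3 : 3 ≤ E.card := by
    obtain ⟨u', c, hc, hcE⟩ := hE
    rw [← hcE, List.toFinset_card_of_nodup hc.edges_nodup, Walk.length_edges]
    exact hc.three_le_length
  obtain ⟨P, hP, hPe, hPvm, hPl, hPs⟩ := hE.exists_isPath_erase hvm
  have hPr := hP.reverse
  obtain ⟨w, hadj, Q, hQ⟩ : ∃ w, ∃ h : G.Adj m w, ∃ Q : G.Walk w v, P.reverse = Walk.cons h Q := by
    cases hp : P.reverse with
    | nil => exact absurd (congrArg Walk.length hp) (by rw [Walk.length_reverse, Walk.length_nil]; omega)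
    | cons h Q => exact ⟨_, h, Q, rfl⟩
  have hmw : s(m, w) ∈ E := by
    have : s(m, w) ∈ P.reverse.edges := by rw [hQ, Walk.edges_cons]; exact List.mem_cons_self
    rw [Walk.edges_reverse, List.mem_reverse, ← List.mem_toFinset, hPe] at this
    exact Finset.mem_of_mem_erase this
  have hwv : w ≠ v := by
    rintro rfl
    have : s(m, w) ∈ P.reverse.edges := by rw [hQ, Walk.edges_cons]; exact List.mem_cons_self
    rw [Walk.edges_reverse, List.mem_reverse] at this
    exact hPvm (by rw [Sym2.eq_swap]; exact this)
  have hwu : w = u := (hm w hmw).resolve_right hwv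
  subst hwu
  have hQp : Q.IsPath := by
    have := hPr; rw [hQ, Walk.cons_isPath_iff] at this; exact this.1
  have hmQ : m ∉ Q.support := by
    have := hPr; rw [hQ, Walk.cons_isPath_iff] at this; exact this.2
  have hQe : Q.edges.toFinset = (E.erase s(w, m)).erase s(m, v) := by
    have h1 : P.reverse.edges.toFinset = E.erase s(v, m) := by
      rw [Walk.edges_reverse, List.toFinset_reverse, hPe]
    rw [hQ, Walk.edges_cons, List.toFinset_cons] at h1
    have hnot : s(m, w) ∉ Q.edges.toFinset := by
      intro h
      exact hmQ (Q.fst_mem_support_of_mem_edges (List.mem_toFinset.1 h))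
    calc Q.edges.toFinset = (insert s(m, w) Q.edges.toFinset).erase s(m, w) := (Finset.erase_insert hnot).symm
      _ = (E.erase s(v, m)).erase s(m, w) := by rw [h1]
      _ = (E.erase s(w, m)).erase s(m, v) := by
          rw [Finset.erase_right_comm, Sym2.eq_swap (a := m) (b := w), Sym2.eq_swap (a := v) (b := m)]
  have hQs : ∀ x ∈ Q.support, ∃ e ∈ E, x ∈ e := fun x hx => by
    have : x ∈ P.reverse.support := by rw [hQ, Walk.support_cons]; exact List.mem_cons_of_mem _ hx
    rw [Walk.support_reverse, List.mem_reverse] at this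
    exact (hPs x).1 this
  have hcyc : (A.append Q.reverse).IsCycle := by
    refine hA.isCycle_append hQp.reverse ?_ (Or.inl (by omega))
    · intro x hxA hxQ
      rw [Walk.support_reverse] at hxQ
      have hxQ' : x ∈ Q.support := by
        have := List.tail_subset _ hxQ
        rwa [List.mem_reverse] at this
      have hxv : x ≠ v := by
        rintro rfl
        have hnd : Q.support.reverse.Nodup := List.nodup_reverse.2 hQp.support_nodup
        have hhead : Q.support.reverse = x :: Q.support.reverse.tail := by
          rw [← List.cons_head_tail (List.reverse_ne_nil_iff.2 Q.support_ne_nil)]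
          congr 1
          rw [List.head_reverse, Q.getLast_support]
        rw [hhead, List.nodup_cons] at hnd
        exact hnd.1 hxQ
      have hxu : x ≠ w := by
        rintro rfl
        have hnd := hA.support_nodup
        rw [← A.cons_tail_support, List.nodup_cons] at hnd
        exact hnd.1 hxA
      obtain ⟨e, he, hxe⟩ := hQs x hxQ'
      exact hint x (List.mem_of_mem_tail hxA) hxu hxv e he hxe
  have hedges : (A.append Q.reverse).edges.toFinset = (E.erase s(w, m)).erase s(m, v) ∪ A.edges.toFinset := by
    rw [Walk.edges_append, Walk.edges_reverse, List.toFinset_append, List.toFinset_reverse, hQe,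
      Finset.union_comm]
  refine ⟨⟨w, _, hcyc, hedges⟩, ?_⟩
  have hQl : Q.length + 2 = E.card := by
    have := congrArg Walk.length hQ; rw [Walk.length_reverse, Walk.length_cons] at this; omega
  have hc := List.toFinset_card_of_nodup hcyc.edges_nodup
  rw [Walk.length_edges, Walk.length_append, Walk.length_reverse, hedges] at hc
  omega

end Generic

/-! ### (2) Brick sites, decidable adjacency, the vertex set of a reroute -/

/-- adjacency of the brick-wall graph is decidable (so that explicit detours can be written with `decide`). [folklore] -/
instance instDecidableRelBrickAdj : DecidableRel brickGraph.Adj := fun u w => by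
  unfold brickGraph; dsimp only; infer_instance

/-- two sites of `ℤ²` are equal iff their coordinates are. [folklore] -/
private theorem site_ext_iff (x y : Site 2) : x = y ↔ x 0 = y 0 ∧ x 1 = y 1 :=
  ⟨fun h => by rw [h]; exact ⟨rfl, rfl⟩, fun h => by funext i; fin_cases i <;> simp [h.1, h.2]⟩

/-- `vec_zero'`. [folklore] -/
@[simp] private theorem vec_zero' (a b : ℤ) : (![a, b] : Site 2) 0 = a := rfl
/-- `vec_one'`. [folklore] -/
@[simp] private theorem vec_one' (a b : ℤ) : (![a, b] : Site 2) 1 = b := rfl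

variable {E : Finset (Sym2 (Site 2))}

/-- polygon edges are brick edges. [folklore] -/
private theorem adj_of_mem (hE : IsPolygon brickGraph E) {v w : Site 2} (h : s(v, w) ∈ E) : brickGraph.Adj v w :=
  hE.mem_edgeSet h

/-- two distinct `E`-neighbours at a vertex of the polygon `E`. [folklore] -/
private theorem two_nbrs (hE : IsPolygon brickGraph E) {v : Site 2} (hv : v ∈ vertsOf E) :
    ∃ w₁ w₂ : Site 2, w₁ ≠ w₂ ∧ s(v, w₁) ∈ E ∧ s(v, w₂) ∈ E ∧ brickGraph.Adj v w₁ ∧ brickGraph.Adj v w₂ :=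
  hE.exists_two_edges (mem_vertsOf.1 hv)

/-- an edge with an endpoint outside `vertsOf E` is not in `E` (left endpoint). [folklore] -/
private theorem not_mem_of_left {v w : Site 2} (hv : v ∉ vertsOf E) : s(v, w) ∉ E :=
  fun h => hv (mem_vertsOf.2 ⟨_, h, Sym2.mem_mk_left _ _⟩)

/-- an edge with an endpoint outside `vertsOf E` is not in `E` (right endpoint). [folklore] -/
private theorem not_mem_of_right {v w : Site 2} (hw : w ∉ vertsOf E) : s(v, w) ∉ E :=
  fun h => hw (mem_vertsOf.2 ⟨_, h, Sym2.mem_mk_right _ _⟩)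

/-- the vertices of a rerouted edge set: old vertices or vertices on the detour. [folklore] -/
private theorem vertsOf_reroute_subset {e : Sym2 (Site 2)} {u v : Site 2} (A : brickGraph.Walk u v) {x : Site 2}
    (hx : x ∈ vertsOf (E.erase e ∪ A.edges.toFinset)) : x ∈ vertsOf E ∨ x ∈ A.support := by
  obtain ⟨f, hf, hxf⟩ := mem_vertsOf.1 hx
  rcases Finset.mem_union.1 hf with h | h
  · exact Or.inl (mem_vertsOf.2 ⟨f, Finset.mem_of_mem_erase h, hxf⟩)
  · right
    rw [List.mem_toFinset] at h
    induction f using Sym2.ind with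
    | _ a b =>
      rcases Sym2.mem_iff.1 hxf with rfl | rfl
      · exact A.fst_mem_support_of_mem_edges h
      · exact A.snd_mem_support_of_mem_edges h

/-- erasing ONE edge of a polygon and adding anything keeps every old vertex (each vertex has two edges). [folklore] -/
private theorem vertsOf_subset_reroute (hE : IsPolygon brickGraph E) {e : Sym2 (Site 2)} {u v : Site 2} (A : brickGraph.Walk u v)
    {x : Site 2} (hx : x ∈ vertsOf E) : x ∈ vertsOf (E.erase e ∪ A.edges.toFinset) := by
  obtain ⟨w₁, w₂, hne, h₁, h₂, -, -⟩ := two_nbrs hE hx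
  by_cases h : s(x, w₁) = e
  · have h' : s(x, w₂) ≠ e := by
      rw [← h]; intro heq
      rcases Sym2.eq_iff.1 heq with ⟨-, h2⟩ | ⟨h1, h2⟩
      · exact hne h2.symm
      · exact hne (h1.symm.trans h2.symm)
    exact mem_vertsOf.2 ⟨_, Finset.mem_union_left _ (Finset.mem_erase.2 ⟨h', h₂⟩), Sym2.mem_mk_left _ _⟩
  · exact mem_vertsOf.2 ⟨_, Finset.mem_union_left _ (Finset.mem_erase.2 ⟨h, h₁⟩), Sym2.mem_mk_left _ _⟩

/-- the vertices after a two-edge reroute: old vertices or vertices on the detour. [folklore] -/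
private theorem vertsOf_reroute₂_subset {e e' : Sym2 (Site 2)} {u v : Site 2} (A : brickGraph.Walk u v) {x : Site 2}
    (hx : x ∈ vertsOf ((E.erase e).erase e' ∪ A.edges.toFinset)) : x ∈ vertsOf E ∨ x ∈ A.support := by
  obtain ⟨f, hf, hxf⟩ := mem_vertsOf.1 hx
  rcases Finset.mem_union.1 hf with h | h
  · exact Or.inl (mem_vertsOf.2 ⟨f, Finset.mem_of_mem_erase (Finset.mem_of_mem_erase h), hxf⟩)
  · right
    rw [List.mem_toFinset] at h
    induction f using Sym2.ind with
    | _ a b =>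
      rcases Sym2.mem_iff.1 hxf with rfl | rfl
      · exact A.fst_mem_support_of_mem_edges h
      · exact A.snd_mem_support_of_mem_edges h

/-- **Undoing a one-edge reroute**: if the detour's edges avoid `E` and `e ∈ E`, then removing the detour's edges from the
rerouted set and putting `e` back gives `E`. [folklore] -/
private theorem reroute_undo {e : Sym2 (Site 2)} {u v : Site 2} (A : brickGraph.Walk u v) (he : e ∈ E)
    (hA : ∀ f ∈ A.edges.toFinset, f ∉ E) :
    insert e ((E.erase e ∪ A.edges.toFinset) \ A.edges.toFinset) = E := by
  ext f
  simp only [Finset.mem_insert, Finset.mem_sdiff, Finset.mem_union, Finset.mem_erase]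
  constructor
  · rintro (rfl | ⟨h | h, hn⟩)
    · exact he
    · exact h.2
    · exact absurd h hn
  · intro hf
    by_cases hfe : f = e
    · exact Or.inl hfe
    · exact Or.inr ⟨Or.inl ⟨hfe, hf⟩, fun h => hA f h hf⟩

/-- **Undoing a two-edge reroute.** [folklore] -/
private theorem reroute₂_undo {e e' : Sym2 (Site 2)} {u v : Site 2} (A : brickGraph.Walk u v) (he : e ∈ E) (he' : e' ∈ E)
    (hA : ∀ f ∈ A.edges.toFinset, f ∉ E) :
    insert e (insert e' (((E.erase e).erase e' ∪ A.edges.toFinset) \ A.edges.toFinset)) = E := by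
  ext f
  simp only [Finset.mem_insert, Finset.mem_sdiff, Finset.mem_union, Finset.mem_erase]
  constructor
  · rintro (rfl | rfl | ⟨h | h, hn⟩)
    · exact he
    · exact he'
    · exact h.2.2
    · exact absurd h hn
  · intro hf
    by_cases hfe : f = e
    · exact Or.inl hfe
    by_cases hfe' : f = e'
    · exact Or.inr (Or.inl hfe')
    · exact Or.inr (Or.inr ⟨Or.inl ⟨hfe', hfe, hf⟩, fun h => hA f h hf⟩)

/-- an edge of a walk whose every edge has an endpoint outside `vertsOf E` is not in `E` — pointwise form used below. [folklore] -/
private theorem not_mem_of_endpoint {a b : Site 2} (h : a ∉ vertsOf E ∨ b ∉ vertsOf E) : s(a, b) ∉ E := by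
  rcases h with h | h
  · exact not_mem_of_left h
  · exact not_mem_of_right h

/-! ### (3) TYPE A: the shared contact site `t = 0` -/

section TypeA

/-- **Type-A corridor hypothesis at the origin**: every vertex of `E` in the rows `−2, …, 2` has `X ≤ 0` (this is what
`le_of_isFirstContact` gives when `0` is a site of both polygons). [cite: Hammond2015SAPJoining, §4.1 p. 18 (arXiv v5): "no vertex of `τ`
belongs to the right corridor"] -/
def CorrA (E : Finset (Sym2 (Site 2))) : Prop := ∀ v ∈ vertsOf E, -2 ≤ v 1 → v 1 ≤ 2 → v 0 ≤ 0

/-- the detour of branch A1: `(−1,1) → (1,1) → (3,1) → (2,0) → (1,−1) → 0` (replaces the edge `(−1,1)–0`).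
[cite: Madras1995LatticeAnimalsExponent, §2 (the local modification); Hammond2015SAPJoining, §4.1 p. 18 (arXiv v5)] -/
def wA1 : brickGraph.Walk (![-1, 1] : Site 2) ![0, 0] :=
  Walk.cons (v := ![1, 1]) (by decide) <| Walk.cons (v := ![3, 1]) (by decide) <| Walk.cons (v := ![2, 0]) (by decide) <|
  Walk.cons (v := ![1, -1]) (by decide) <| Walk.cons (v := ![0, 0]) (by decide) Walk.nil

/-- the detour of branch A2: `(−1,−1) → (1,−1) → (2,0) → (3,1) → (1,1) → 0` (replaces the edge `(−1,−1)–0`).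
[cite: Madras1995LatticeAnimalsExponent, §2 (the local modification); Hammond2015SAPJoining, §4.1 p. 18 (arXiv v5)] -/
def wA2 : brickGraph.Walk (![-1, -1] : Site 2) ![0, 0] :=
  Walk.cons (v := ![1, -1]) (by decide) <| Walk.cons (v := ![2, 0]) (by decide) <| Walk.cons (v := ![3, 1]) (by decide) <|
  Walk.cons (v := ![1, 1]) (by decide) <| Walk.cons (v := ![0, 0]) (by decide) Walk.nil

/-- `wA1` is self-avoiding. [folklore] -/
private theorem wA1_isPath : wA1.IsPath := by rw [Walk.isPath_def]; decide
/-- `wA2` is self-avoiding. [folklore] -/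
private theorem wA2_isPath : wA2.IsPath := by rw [Walk.isPath_def]; decide
/-- `wA1` has length 5. [folklore] -/
private theorem wA1_length : wA1.length = 5 := by decide
/-- `wA2` has length 5. [folklore] -/
private theorem wA2_length : wA2.length = 5 := by decide
/-- the sites of `wA1`. [folklore] -/
private theorem wA1_support : wA1.support = [![-1, 1], ![1, 1], ![3, 1], ![2, 0], ![1, -1], ![0, 0]] := by decide
/-- the sites of `wA2`. [folklore] -/
private theorem wA2_support : wA2.support = [![-1, -1], ![1, -1], ![2, 0], ![3, 1], ![1, 1], ![0, 0]] := by decide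

/-- The four NEW sites of the type-A detours, `(1,1), (3,1), (2,0), (1,−1)`, are not vertices of `E` under `CorrA`. [cite: Hammond2015SAPJoining, §4.1 p. 18 (arXiv v5): the empty right corridor] -/
private theorem newA_not_vert (hC : CorrA E) {x : Site 2}
    (hx : x = ![1, 1] ∨ x = ![3, 1] ∨ x = ![2, 0] ∨ x = ![1, -1]) : x ∉ vertsOf E := by
  intro hv
  have h := hC x hv
  rcases hx with rfl | rfl | rfl | rfl <;> simp at h

/-- The four new sites of the type-A detours are not vertices of `E` (public form). [cite: Hammond2015SAPJoining, §4.1 p. 18 (arXiv v5)] -/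
theorem newA_not_vert' (hC : CorrA E) {x : Site 2}
    (hx : x = ![1, 1] ∨ x = ![3, 1] ∨ x = ![2, 0] ∨ x = ![1, -1]) : x ∉ vertsOf E := newA_not_vert hC hx

open Classical in
/-- **The type-A rule at the origin**: branch A1 if the edge `(−1,1)–0` is in `E`, else branch A2.
[cite: Madras1995LatticeAnimalsExponent, §2; Hammond2015SAPJoining, §4.1 p. 18 (arXiv v5)] -/
def capA (E : Finset (Sym2 (Site 2))) : Finset (Sym2 (Site 2)) :=
  if s((![-1, 1] : Site 2), ![0, 0]) ∈ E then E.erase s((![-1, 1] : Site 2), ![0, 0]) ∪ wA1.edges.toFinset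
  else E.erase s((![-1, -1] : Site 2), ![0, 0]) ∪ wA2.edges.toFinset

/-- Under `CorrA`, the `E`-neighbours of `0` are among `(−2,0), (−1,1), (−1,−1)`. [cite: Hammond2015SAPJoining, §4.1 p. 18 (arXiv v5)] -/
private theorem nbr_zero_cases (hE : IsPolygon brickGraph E) (hC : CorrA E) {w : Site 2} (hw : s((![0, 0] : Site 2), w) ∈ E) :
    w = ![-2, 0] ∨ w = ![-1, 1] ∨ w = ![-1, -1] := by
  have ha := (brickGraph_adj_iff _ _).1 (adj_of_mem hE hw)
  have hv : w ∈ vertsOf E := mem_vertsOf.2 ⟨_, hw, Sym2.mem_mk_right _ _⟩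
  have hc := hC w hv
  simp only [vec_zero', vec_one'] at ha
  have : w 0 ≤ 0 := hc (by omega) (by omega)
  rcases ha with ⟨h1, h0⟩ | ⟨h1, h0⟩
  · left; rw [site_ext_iff]; simp; omega
  · rcases h1 with h1 | h1
    · right; left; rw [site_ext_iff]; simp; omega
    · right; right; rw [site_ext_iff]; simp; omega

/-- Under `CorrA`, if `(−1,1)–0 ∉ E` and `0` is a vertex then `(−1,−1)–0 ∈ E`. [cite: Hammond2015SAPJoining, §4.1 p. 18 (arXiv v5)] -/
private theorem sw_edge_of_not_nw (hE : IsPolygon brickGraph E) (hC : CorrA E) (h0 : (![0, 0] : Site 2) ∈ vertsOf E)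
    (hnw : s((![-1, 1] : Site 2), ![0, 0]) ∉ E) : s((![-1, -1] : Site 2), ![0, 0]) ∈ E := by
  obtain ⟨w₁, w₂, hne, h₁, h₂, -, -⟩ := two_nbrs hE h0
  have hnw' : ∀ w, s((![0, 0] : Site 2), w) ∈ E → w ≠ ![-1, 1] := by
    rintro w hw rfl; rw [Sym2.eq_swap] at hw; exact hnw hw
  rcases nbr_zero_cases hE hC h₁ with e₁ | e₁ | e₁ <;> rcases nbr_zero_cases hE hC h₂ with e₂ | e₂ | e₂
  all_goals first
    | exact absurd (e₁.trans e₂.symm) hne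
    | exact absurd e₁ (hnw' _ h₁)
    | exact absurd e₂ (hnw' _ h₂)
    | (rw [Sym2.eq_swap, ← e₁]; exact h₁)
    | (rw [Sym2.eq_swap, ← e₂]; exact h₂)

/-- **Type A: the capped edge set is a brick polygon with four more edges.**
[cite: Madras1995LatticeAnimalsExponent, §2; Hammond2015SAPJoining, §4.1 p. 18 (arXiv v5): "`τ_mod` has length `n + 8`" on `ℤ²`; here `+4` on `𝕋`] -/
theorem capA_isPolygon_card (hE : IsPolygon brickGraph E) (hC : CorrA E) (h0 : (![0, 0] : Site 2) ∈ vertsOf E) :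
    IsPolygon brickGraph (capA E) ∧ (capA E).card = E.card + 4 := by
  classical
  unfold capA
  split_ifs with hnw
  · have hint : ∀ x ∈ wA1.support, x ≠ ![-1, 1] → x ≠ ![0, 0] → ∀ e ∈ E, x ∉ e := by
      intro x hx hxu hxv e he hxe
      rw [wA1_support] at hx
      simp only [List.mem_cons, List.not_mem_nil, or_false] at hx
      rcases hx with rfl | h
      · exact hxu rfl
      rcases h with rfl | rfl | rfl | rfl | rfl
      · exact newA_not_vert hC (Or.inl rfl) (mem_vertsOf.2 ⟨e, he, hxe⟩)
      · exact newA_not_vert hC (Or.inr (Or.inl rfl)) (mem_vertsOf.2 ⟨e, he, hxe⟩)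
      · exact newA_not_vert hC (Or.inr (Or.inr (Or.inl rfl))) (mem_vertsOf.2 ⟨e, he, hxe⟩)
      · exact newA_not_vert hC (Or.inr (Or.inr (Or.inr rfl))) (mem_vertsOf.2 ⟨e, he, hxe⟩)
      · exact hxv rfl
    obtain ⟨hP, hc⟩ := reroute_one hE hnw wA1_isPath (by rw [wA1_length]; omega) hint
    exact ⟨hP, by rw [wA1_length] at hc; omega⟩
  · have hsw := sw_edge_of_not_nw hE hC h0 hnw
    have hint : ∀ x ∈ wA2.support, x ≠ ![-1, -1] → x ≠ ![0, 0] → ∀ e ∈ E, x ∉ e := by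
      intro x hx hxu hxv e he hxe
      rw [wA2_support] at hx
      simp only [List.mem_cons, List.not_mem_nil, or_false] at hx
      rcases hx with rfl | h
      · exact hxu rfl
      rcases h with rfl | rfl | rfl | rfl | rfl
      · exact newA_not_vert hC (Or.inr (Or.inr (Or.inr rfl))) (mem_vertsOf.2 ⟨e, he, hxe⟩)
      · exact newA_not_vert hC (Or.inr (Or.inr (Or.inl rfl))) (mem_vertsOf.2 ⟨e, he, hxe⟩)
      · exact newA_not_vert hC (Or.inr (Or.inl rfl)) (mem_vertsOf.2 ⟨e, he, hxe⟩)
      · exact newA_not_vert hC (Or.inl rfl) (mem_vertsOf.2 ⟨e, he, hxe⟩)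
      · exact hxv rfl
    obtain ⟨hP, hc⟩ := reroute_one hE hsw wA2_isPath (by rw [wA2_length]; omega) hint
    exact ⟨hP, by rw [wA2_length] at hc; omega⟩

/-- **Type A: the NE-line `(1,−1) – (2,0) – (3,1)` lies in the capped polygon** (its upper edge is the left side of the junction rhombus
when `E` is the left polygon, its lower edge — after the π-rotation — when `E` is the right polygon).
[cite: Hammond2015SAPJoining, §4.1 p. 18 (arXiv v5): "two vertical edges that cross the right corridor at the maximal x-coordinate"] -/
theorem ne_edges_capA (E : Finset (Sym2 (Site 2))) :
    s((![2, 0] : Site 2), ![3, 1]) ∈ capA E ∧ s((![1, -1] : Site 2), ![2, 0]) ∈ capA E := by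
  classical
  unfold capA
  split_ifs
  · constructor <;> (apply Finset.mem_union_right; rw [List.mem_toFinset]; decide)
  · constructor <;> (apply Finset.mem_union_right; rw [List.mem_toFinset]; decide)

/-- **Type A: the vertices of the capped polygon** are vertices of `E` or among the four new sites `(1,1), (3,1), (2,0), (1,−1)`.
[cite: Hammond2015SAPJoining, §4.1 p. 18 (arXiv v5)] -/
theorem vertsOf_capA_subset (hE : IsPolygon brickGraph E) (hC : CorrA E) (h0 : (![0, 0] : Site 2) ∈ vertsOf E)
    {x : Site 2} (hx : x ∈ vertsOf (capA E)) :
    x ∈ vertsOf E ∨ (x = ![1, 1] ∨ x = ![3, 1] ∨ x = ![2, 0] ∨ x = ![1, -1]) := by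
  classical
  unfold capA at hx
  split_ifs at hx with hnw
  · rcases vertsOf_reroute_subset wA1 hx with h | h
    · exact Or.inl h
    · rw [wA1_support] at h
      simp only [List.mem_cons, List.not_mem_nil, or_false] at h
      rcases h with rfl | rfl | rfl | rfl | rfl | rfl
      · exact Or.inl (mem_vertsOf.2 ⟨_, hnw, Sym2.mem_mk_left _ _⟩)
      · exact Or.inr (Or.inl rfl)
      · exact Or.inr (Or.inr (Or.inl rfl))
      · exact Or.inr (Or.inr (Or.inr (Or.inl rfl)))
      · exact Or.inr (Or.inr (Or.inr (Or.inr rfl)))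
      · exact Or.inl h0
  · have hsw := sw_edge_of_not_nw hE hC h0 hnw
    rcases vertsOf_reroute_subset wA2 hx with h | h
    · exact Or.inl h
    · rw [wA2_support] at h
      simp only [List.mem_cons, List.not_mem_nil, or_false] at h
      rcases h with rfl | rfl | rfl | rfl | rfl | rfl
      · exact Or.inl (mem_vertsOf.2 ⟨_, hsw, Sym2.mem_mk_left _ _⟩)
      · exact Or.inr (Or.inr (Or.inr (Or.inr rfl)))
      · exact Or.inr (Or.inr (Or.inr (Or.inl rfl)))
      · exact Or.inr (Or.inr (Or.inl rfl))
      · exact Or.inr (Or.inl rfl)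
      · exact Or.inl h0

/-- **Type A: every vertex of `E` is still a vertex of the capped polygon** (the type-A detours drop no site).
[cite: Hammond2015SAPJoining, §4.1 p. 18 (arXiv v5)] -/
theorem vertsOf_subset_capA (hE : IsPolygon brickGraph E) {x : Site 2} (hx : x ∈ vertsOf E) : x ∈ vertsOf (capA E) := by
  classical
  unfold capA
  split_ifs
  · exact vertsOf_subset_reroute hE wA1 hx
  · exact vertsOf_subset_reroute hE wA2 hx

/-- **Type A, frontier of the new sites**: a vertex of `capA E` that is not a vertex of `E` lies in the rows `−1, 0, 1`, right of
the axis (`X ≥ 1`) and on or left of the diagonal line `X − Y = 2` through the junction edge `(2,0)–(3,1)`.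
[cite: Hammond2015SAPJoining, §4.1 p. 18 (arXiv v5)] -/
theorem new_vert_capA (hE : IsPolygon brickGraph E) (hC : CorrA E) (h0 : (![0, 0] : Site 2) ∈ vertsOf E)
    {x : Site 2} (hx : x ∈ vertsOf (capA E)) (hnew : x ∉ vertsOf E) :
    -1 ≤ x 1 ∧ x 1 ≤ 1 ∧ 1 ≤ x 0 ∧ x 0 - x 1 ≤ 2 := by
  rcases vertsOf_capA_subset hE hC h0 hx with h | h
  · exact absurd h hnew
  · rcases h with rfl | rfl | rfl | rfl <;> simp

/-- the edges of `wA1` avoid `E` under `CorrA` (each has a corridor endpoint). [cite: Hammond2015SAPJoining, §4.1 p. 18 (arXiv v5)] -/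
private theorem wA1_edges_not_mem (hC : CorrA E) : ∀ f ∈ wA1.edges.toFinset, f ∉ E := by
  intro f hf
  have : wA1.edges = [s(![-1, 1], ![1, 1]), s(![1, 1], ![3, 1]), s(![3, 1], ![2, 0]), s(![2, 0], ![1, -1]),
      s(![1, -1], ![0, 0])] := by decide
  rw [this] at hf
  simp only [List.toFinset_cons, List.toFinset_nil, Finset.mem_insert, Finset.notMem_empty, or_false] at hf
  rcases hf with rfl | rfl | rfl | rfl | rfl
  · exact not_mem_of_endpoint (Or.inr (newA_not_vert hC (Or.inl rfl)))
  · exact not_mem_of_endpoint (Or.inl (newA_not_vert hC (Or.inl rfl)))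
  · exact not_mem_of_endpoint (Or.inl (newA_not_vert hC (Or.inr (Or.inl rfl))))
  · exact not_mem_of_endpoint (Or.inl (newA_not_vert hC (Or.inr (Or.inr (Or.inl rfl)))))
  · exact not_mem_of_endpoint (Or.inl (newA_not_vert hC (Or.inr (Or.inr (Or.inr rfl)))))

/-- the edges of `wA2` avoid `E` under `CorrA`. [cite: Hammond2015SAPJoining, §4.1 p. 18 (arXiv v5)] -/
private theorem wA2_edges_not_mem (hC : CorrA E) : ∀ f ∈ wA2.edges.toFinset, f ∉ E := by
  intro f hf
  have : wA2.edges = [s(![-1, -1], ![1, -1]), s(![1, -1], ![2, 0]), s(![2, 0], ![3, 1]), s(![3, 1], ![1, 1]),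
      s(![1, 1], ![0, 0])] := by decide
  rw [this] at hf
  simp only [List.toFinset_cons, List.toFinset_nil, Finset.mem_insert, Finset.notMem_empty, or_false] at hf
  rcases hf with rfl | rfl | rfl | rfl | rfl
  · exact not_mem_of_endpoint (Or.inr (newA_not_vert hC (Or.inr (Or.inr (Or.inr rfl)))))
  · exact not_mem_of_endpoint (Or.inl (newA_not_vert hC (Or.inr (Or.inr (Or.inr rfl)))))
  · exact not_mem_of_endpoint (Or.inl (newA_not_vert hC (Or.inr (Or.inr (Or.inl rfl)))))
  · exact not_mem_of_endpoint (Or.inl (newA_not_vert hC (Or.inr (Or.inl rfl))))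
  · exact not_mem_of_endpoint (Or.inl (newA_not_vert hC (Or.inl rfl)))

/-- **Branch legibility, type A**: the edge `(−1,1)–(1,1)` is in `capA E` iff branch A1 applies. [cite: Madras1995LatticeAnimalsExponent, §2 (decoding the join)] -/
theorem capA_branch_iff (hC : CorrA E) :
    s((![-1, 1] : Site 2), ![1, 1]) ∈ capA E ↔ s((![-1, 1] : Site 2), ![0, 0]) ∈ E := by
  classical
  unfold capA
  split_ifs with h
  · simp only [h, iff_true]
    exact Finset.mem_union_right _ (by rw [List.mem_toFinset]; decide)
  · simp only [h, iff_false]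
    intro hm
    rcases Finset.mem_union.1 hm with hm | hm
    · exact not_mem_of_right (newA_not_vert hC (Or.inl rfl)) (Finset.mem_of_mem_erase hm)
    · rw [List.mem_toFinset] at hm; revert hm; decide

/-- **Type A: the rule is injective** on polygons satisfying the type-A hypothesis (decoding: read the branch off the capped
polygon, delete the detour, restore the edge). [cite: Madras1995LatticeAnimalsExponent, §2 (the join is injective)] -/
theorem capA_injective {E₁ E₂ : Finset (Sym2 (Site 2))} (hC₁ : CorrA E₁) (hC₂ : CorrA E₂)
    (h0₁ : (![0, 0] : Site 2) ∈ vertsOf E₁) (h0₂ : (![0, 0] : Site 2) ∈ vertsOf E₂)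
    (hE₁ : IsPolygon brickGraph E₁) (hE₂ : IsPolygon brickGraph E₂) (h : capA E₁ = capA E₂) : E₁ = E₂ := by
  classical
  have hb : (s((![-1, 1] : Site 2), ![0, 0]) ∈ E₁) ↔ (s((![-1, 1] : Site 2), ![0, 0]) ∈ E₂) := by
    rw [← capA_branch_iff hC₁, ← capA_branch_iff hC₂, h]
  by_cases h1 : s((![-1, 1] : Site 2), ![0, 0]) ∈ E₁
  · have h2 := hb.1 h1
    have c1 : capA E₁ = E₁.erase s((![-1, 1] : Site 2), ![0, 0]) ∪ wA1.edges.toFinset := by unfold capA; rw [if_pos h1]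
    have c2 : capA E₂ = E₂.erase s((![-1, 1] : Site 2), ![0, 0]) ∪ wA1.edges.toFinset := by unfold capA; rw [if_pos h2]
    rw [← reroute_undo wA1 h1 (wA1_edges_not_mem hC₁), ← reroute_undo wA1 h2 (wA1_edges_not_mem hC₂), ← c1, ← c2, h]
  · have h2 : s((![-1, 1] : Site 2), ![0, 0]) ∉ E₂ := fun h' => h1 (hb.2 h')
    have s1 := sw_edge_of_not_nw hE₁ hC₁ h0₁ h1
    have s2 := sw_edge_of_not_nw hE₂ hC₂ h0₂ h2
    have c1 : capA E₁ = E₁.erase s((![-1, -1] : Site 2), ![0, 0]) ∪ wA2.edges.toFinset := by unfold capA; rw [if_neg h1]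
    have c2 : capA E₂ = E₂.erase s((![-1, -1] : Site 2), ![0, 0]) ∪ wA2.edges.toFinset := by unfold capA; rw [if_neg h2]
    rw [← reroute_undo wA2 s1 (wA2_edges_not_mem hC₁), ← reroute_undo wA2 s2 (wA2_edges_not_mem hC₂), ← c1, ← c2, h]

end TypeA

/-! ### (4) TYPE B: a column contact `t = (0,1)` above `w = (0,−1)` -/

section TypeB

/-- **Type-B hypothesis at the centre `0`** (`t = (0,1) ∈ E`, partner `w = (0,−1)` in the other polygon): every vertex of `E` in the
rows `−3, …, 1` has `X ≤ 0` (`le_of_isFirstContact` w.r.t. `w`), and `(0,−1), (−1,0), (−1,−2)` are not vertices of `E` (no shared site,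
no diagonal contact pair — the selection rule of the design note). [cite: Hammond2015SAPJoining, §4.1 p. 18 (arXiv v5): the empty right corridor] -/
def CorrB (E : Finset (Sym2 (Site 2))) : Prop :=
  (∀ v ∈ vertsOf E, -3 ≤ v 1 → v 1 ≤ 1 → v 0 ≤ 0) ∧
    (![0, -1] : Site 2) ∉ vertsOf E ∧ (![-1, 0] : Site 2) ∉ vertsOf E ∧ (![-1, -2] : Site 2) ∉ vertsOf E

/-- the detour of branch B1: `(−2,1) → (−1,0) → (0,−1) → (1,0) → (2,1) → (0,1)` (replaces the edge `(−2,1)–(0,1)`).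
[cite: Madras1995LatticeAnimalsExponent, §2; Hammond2015SAPJoining, §4.1 p. 18 (arXiv v5)] -/
def wB1 : brickGraph.Walk (![-2, 1] : Site 2) ![0, 1] :=
  Walk.cons (v := ![-1, 0]) (by decide) <| Walk.cons (v := ![0, -1]) (by decide) <| Walk.cons (v := ![1, 0]) (by decide) <|
  Walk.cons (v := ![2, 1]) (by decide) <| Walk.cons (v := ![0, 1]) (by decide) Walk.nil

/-- the detour of branch B2: `(0,1) → (−1,0) → (0,−1) → (1,0) → (2,1) → (1,2)` (replaces the edge `(0,1)–(1,2)`).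
[cite: Madras1995LatticeAnimalsExponent, §2; Hammond2015SAPJoining, §4.1 p. 18 (arXiv v5)] -/
def wB2 : brickGraph.Walk (![0, 1] : Site 2) ![1, 2] :=
  Walk.cons (v := ![-1, 0]) (by decide) <| Walk.cons (v := ![0, -1]) (by decide) <| Walk.cons (v := ![1, 0]) (by decide) <|
  Walk.cons (v := ![2, 1]) (by decide) <| Walk.cons (v := ![1, 2]) (by decide) Walk.nil

/-- `wB1` is self-avoiding. [folklore] -/
private theorem wB1_isPath : wB1.IsPath := by rw [Walk.isPath_def]; decide
/-- `wB2` is self-avoiding. [folklore] -/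
private theorem wB2_isPath : wB2.IsPath := by rw [Walk.isPath_def]; decide
/-- `wB1` has length 5. [folklore] -/
private theorem wB1_length : wB1.length = 5 := by decide
/-- `wB2` has length 5. [folklore] -/
private theorem wB2_length : wB2.length = 5 := by decide
/-- the sites of `wB1`. [folklore] -/
private theorem wB1_support : wB1.support = [![-2, 1], ![-1, 0], ![0, -1], ![1, 0], ![2, 1], ![0, 1]] := by decide
/-- the sites of `wB2`. [folklore] -/
private theorem wB2_support : wB2.support = [![0, 1], ![-1, 0], ![0, -1], ![1, 0], ![2, 1], ![1, 2]] := by decide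

/-- The four NEW sites of the type-B detours, `(−1,0), (0,−1), (1,0), (2,1)`, are not vertices of `E` under `CorrB`. [cite: Hammond2015SAPJoining, §4.1 p. 18 (arXiv v5)] -/
private theorem newB_not_vert (hC : CorrB E) {x : Site 2}
    (hx : x = ![-1, 0] ∨ x = ![0, -1] ∨ x = ![1, 0] ∨ x = ![2, 1]) : x ∉ vertsOf E := by
  obtain ⟨hrow, h1, h2, -⟩ := hC
  rcases hx with rfl | rfl | rfl | rfl
  · exact h2
  · exact h1
  · intro hv; have h := hrow _ hv; simp at h
  · intro hv; have h := hrow _ hv; simp at h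

/-- The four new sites of the type-B detours are not vertices of `E` (public form). [cite: Hammond2015SAPJoining, §4.1 p. 18 (arXiv v5)] -/
theorem newB_not_vert' (hC : CorrB E) {x : Site 2}
    (hx : x = ![-1, 0] ∨ x = ![0, -1] ∨ x = ![1, 0] ∨ x = ![2, 1]) : x ∉ vertsOf E := newB_not_vert hC hx

open Classical in
/-- **The type-B rule at the centre**: branch B1 if the edge `(−2,1)–(0,1)` is in `E`, else branch B2.
[cite: Madras1995LatticeAnimalsExponent, §2; Hammond2015SAPJoining, §4.1 p. 18 (arXiv v5)] -/
def capB (E : Finset (Sym2 (Site 2))) : Finset (Sym2 (Site 2)) :=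
  if s((![-2, 1] : Site 2), ![0, 1]) ∈ E then E.erase s((![-2, 1] : Site 2), ![0, 1]) ∪ wB1.edges.toFinset
  else E.erase s((![0, 1] : Site 2), ![1, 2]) ∪ wB2.edges.toFinset

/-- Under `CorrB`, the `E`-neighbours of `t = (0,1)` are among `(−2,1), (−1,2), (1,2)`. [cite: Hammond2015SAPJoining, §4.1 p. 18 (arXiv v5)] -/
private theorem nbr_t_casesB (hE : IsPolygon brickGraph E) (hC : CorrB E) {w : Site 2} (hw : s((![0, 1] : Site 2), w) ∈ E) :
    w = ![-2, 1] ∨ w = ![-1, 2] ∨ w = ![1, 2] := by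
  have ha := (brickGraph_adj_iff _ _).1 (adj_of_mem hE hw)
  have hv : w ∈ vertsOf E := mem_vertsOf.2 ⟨_, hw, Sym2.mem_mk_right _ _⟩
  obtain ⟨hrow, -, hL0, -⟩ := hC
  have hc := hrow w hv
  simp only [vec_zero', vec_one'] at ha
  have hne : w ≠ ![-1, 0] := fun h => hL0 (h ▸ hv)
  rw [Ne, site_ext_iff] at hne
  simp only [vec_zero', vec_one'] at hne
  rcases ha with ⟨h1, h0⟩ | ⟨h1, h0⟩
  · have : w 0 ≤ 0 := hc (by omega) (by omega)
    left; rw [site_ext_iff]; simp; omega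
  · rcases h1 with h1 | h1
    · rcases h0 with h0 | h0
      · right; right; rw [site_ext_iff]; simp; omega
      · right; left; rw [site_ext_iff]; simp; omega
    · have : w 0 ≤ 0 := hc (by omega) (by omega)
      exfalso; omega

/-- Under `CorrB`, if `(−2,1)–t ∉ E` and `t = (0,1)` is a vertex then `t–(1,2) ∈ E`. [cite: Hammond2015SAPJoining, §4.1 p. 18 (arXiv v5)] -/
private theorem ne_edge_of_not_w (hE : IsPolygon brickGraph E) (hC : CorrB E) (ht : (![0, 1] : Site 2) ∈ vertsOf E)
    (hnw : s((![-2, 1] : Site 2), ![0, 1]) ∉ E) : s((![0, 1] : Site 2), ![1, 2]) ∈ E := by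
  obtain ⟨w₁, w₂, hne, h₁, h₂, -, -⟩ := two_nbrs hE ht
  have hnw' : ∀ w, s((![0, 1] : Site 2), w) ∈ E → w ≠ ![-2, 1] := by
    rintro w hw rfl; rw [Sym2.eq_swap] at hw; exact hnw hw
  rcases nbr_t_casesB hE hC h₁ with e₁ | e₁ | e₁ <;> rcases nbr_t_casesB hE hC h₂ with e₂ | e₂ | e₂
  all_goals first
    | exact absurd (e₁.trans e₂.symm) hne
    | exact absurd e₁ (hnw' _ h₁)
    | exact absurd e₂ (hnw' _ h₂)
    | (rw [← e₁]; exact h₁)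
    | (rw [← e₂]; exact h₂)

/-- **Type B: the capped edge set is a brick polygon with four more edges.**
[cite: Madras1995LatticeAnimalsExponent, §2; Hammond2015SAPJoining, §4.1 p. 18 (arXiv v5)] -/
theorem capB_isPolygon_card (hE : IsPolygon brickGraph E) (hC : CorrB E) (ht : (![0, 1] : Site 2) ∈ vertsOf E) :
    IsPolygon brickGraph (capB E) ∧ (capB E).card = E.card + 4 := by
  classical
  unfold capB
  split_ifs with hnw
  · have hint : ∀ x ∈ wB1.support, x ≠ ![-2, 1] → x ≠ ![0, 1] → ∀ e ∈ E, x ∉ e := by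
      intro x hx hxu hxv e he hxe
      rw [wB1_support] at hx
      simp only [List.mem_cons, List.not_mem_nil, or_false] at hx
      rcases hx with rfl | h
      · exact hxu rfl
      rcases h with rfl | rfl | rfl | rfl | rfl
      · exact newB_not_vert hC (Or.inl rfl) (mem_vertsOf.2 ⟨e, he, hxe⟩)
      · exact newB_not_vert hC (Or.inr (Or.inl rfl)) (mem_vertsOf.2 ⟨e, he, hxe⟩)
      · exact newB_not_vert hC (Or.inr (Or.inr (Or.inl rfl))) (mem_vertsOf.2 ⟨e, he, hxe⟩)
      · exact newB_not_vert hC (Or.inr (Or.inr (Or.inr rfl))) (mem_vertsOf.2 ⟨e, he, hxe⟩)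
      · exact hxv rfl
    obtain ⟨hP, hc⟩ := reroute_one hE hnw wB1_isPath (by rw [wB1_length]; omega) hint
    exact ⟨hP, by rw [wB1_length] at hc; omega⟩
  · have hsw := ne_edge_of_not_w hE hC ht hnw
    have hint : ∀ x ∈ wB2.support, x ≠ ![0, 1] → x ≠ ![1, 2] → ∀ e ∈ E, x ∉ e := by
      intro x hx hxu hxv e he hxe
      rw [wB2_support] at hx
      simp only [List.mem_cons, List.not_mem_nil, or_false] at hx
      rcases hx with rfl | h
      · exact hxu rfl
      rcases h with rfl | rfl | rfl | rfl | rfl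
      · exact newB_not_vert hC (Or.inl rfl) (mem_vertsOf.2 ⟨e, he, hxe⟩)
      · exact newB_not_vert hC (Or.inr (Or.inl rfl)) (mem_vertsOf.2 ⟨e, he, hxe⟩)
      · exact newB_not_vert hC (Or.inr (Or.inr (Or.inl rfl))) (mem_vertsOf.2 ⟨e, he, hxe⟩)
      · exact newB_not_vert hC (Or.inr (Or.inr (Or.inr rfl))) (mem_vertsOf.2 ⟨e, he, hxe⟩)
      · exact hxv rfl
    obtain ⟨hP, hc⟩ := reroute_one hE hsw wB2_isPath (by rw [wB2_length]; omega) hint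
    exact ⟨hP, by rw [wB2_length] at hc; omega⟩

/-- **Type B: the NE-line `(0,−1) – (1,0) – (2,1)` lies in the capped polygon.**
[cite: Hammond2015SAPJoining, §4.1 p. 18 (arXiv v5)] -/
theorem ne_edges_capB (E : Finset (Sym2 (Site 2))) :
    s((![1, 0] : Site 2), ![2, 1]) ∈ capB E ∧ s((![0, -1] : Site 2), ![1, 0]) ∈ capB E := by
  classical
  unfold capB
  split_ifs
  · constructor <;> (apply Finset.mem_union_right; rw [List.mem_toFinset]; decide)
  · constructor <;> (apply Finset.mem_union_right; rw [List.mem_toFinset]; decide)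

/-- **Type B: the vertices of the capped polygon** are vertices of `E` or among `(−1,0), (0,−1), (1,0), (2,1)`.
[cite: Hammond2015SAPJoining, §4.1 p. 18 (arXiv v5)] -/
theorem vertsOf_capB_subset (hE : IsPolygon brickGraph E) (hC : CorrB E) (ht : (![0, 1] : Site 2) ∈ vertsOf E)
    {x : Site 2} (hx : x ∈ vertsOf (capB E)) :
    x ∈ vertsOf E ∨ (x = ![-1, 0] ∨ x = ![0, -1] ∨ x = ![1, 0] ∨ x = ![2, 1]) := by
  classical
  unfold capB at hx
  split_ifs at hx with hnw
  · rcases vertsOf_reroute_subset wB1 hx with h | h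
    · exact Or.inl h
    · rw [wB1_support] at h
      simp only [List.mem_cons, List.not_mem_nil, or_false] at h
      rcases h with rfl | rfl | rfl | rfl | rfl | rfl
      · exact Or.inl (mem_vertsOf.2 ⟨_, hnw, Sym2.mem_mk_left _ _⟩)
      · exact Or.inr (Or.inl rfl)
      · exact Or.inr (Or.inr (Or.inl rfl))
      · exact Or.inr (Or.inr (Or.inr (Or.inl rfl)))
      · exact Or.inr (Or.inr (Or.inr (Or.inr rfl)))
      · exact Or.inl ht
  · have hsw := ne_edge_of_not_w hE hC ht hnw
    rcases vertsOf_reroute_subset wB2 hx with h | h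
    · exact Or.inl h
    · rw [wB2_support] at h
      simp only [List.mem_cons, List.not_mem_nil, or_false] at h
      rcases h with rfl | rfl | rfl | rfl | rfl | rfl
      · exact Or.inl ht
      · exact Or.inr (Or.inl rfl)
      · exact Or.inr (Or.inr (Or.inl rfl))
      · exact Or.inr (Or.inr (Or.inr (Or.inl rfl)))
      · exact Or.inr (Or.inr (Or.inr (Or.inr rfl)))
      · exact Or.inl (mem_vertsOf.2 ⟨_, hsw, Sym2.mem_mk_right _ _⟩)

/-- **Type B: every vertex of `E` is still a vertex of the capped polygon.** [cite: Hammond2015SAPJoining, §4.1 p. 18 (arXiv v5)] -/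
theorem vertsOf_subset_capB (hE : IsPolygon brickGraph E) {x : Site 2} (hx : x ∈ vertsOf E) : x ∈ vertsOf (capB E) := by
  classical
  unfold capB
  split_ifs
  · exact vertsOf_subset_reroute hE wB1 hx
  · exact vertsOf_subset_reroute hE wB2 hx

/-- **Type B, frontier of the new sites**: a vertex of `capB E` that is not a vertex of `E` lies in the rows `−1, 0, 1`, has
`X ≥ −1`, and lies on or left of the line `X − Y = 1` through the junction edge `(1,0)–(2,1)`.
[cite: Hammond2015SAPJoining, §4.1 p. 18 (arXiv v5)] -/
theorem new_vert_capB (hE : IsPolygon brickGraph E) (hC : CorrB E) (ht : (![0, 1] : Site 2) ∈ vertsOf E)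
    {x : Site 2} (hx : x ∈ vertsOf (capB E)) (hnew : x ∉ vertsOf E) :
    -1 ≤ x 1 ∧ x 1 ≤ 1 ∧ -1 ≤ x 0 ∧ x 0 - x 1 ≤ 1 := by
  rcases vertsOf_capB_subset hE hC ht hx with h | h
  · exact absurd h hnew
  · rcases h with rfl | rfl | rfl | rfl <;> simp

/-- the edges of `wB1` avoid `E` under `CorrB`. [cite: Hammond2015SAPJoining, §4.1 p. 18 (arXiv v5)] -/
private theorem wB1_edges_not_mem (hC : CorrB E) : ∀ f ∈ wB1.edges.toFinset, f ∉ E := by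
  intro f hf
  have : wB1.edges = [s(![-2, 1], ![-1, 0]), s(![-1, 0], ![0, -1]), s(![0, -1], ![1, 0]), s(![1, 0], ![2, 1]),
      s(![2, 1], ![0, 1])] := by decide
  rw [this] at hf
  simp only [List.toFinset_cons, List.toFinset_nil, Finset.mem_insert, Finset.notMem_empty, or_false] at hf
  rcases hf with rfl | rfl | rfl | rfl | rfl
  · exact not_mem_of_endpoint (Or.inr (newB_not_vert hC (Or.inl rfl)))
  · exact not_mem_of_endpoint (Or.inl (newB_not_vert hC (Or.inl rfl)))
  · exact not_mem_of_endpoint (Or.inl (newB_not_vert hC (Or.inr (Or.inl rfl))))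
  · exact not_mem_of_endpoint (Or.inl (newB_not_vert hC (Or.inr (Or.inr (Or.inl rfl)))))
  · exact not_mem_of_endpoint (Or.inl (newB_not_vert hC (Or.inr (Or.inr (Or.inr rfl)))))

/-- the edges of `wB2` avoid `E` under `CorrB`. [cite: Hammond2015SAPJoining, §4.1 p. 18 (arXiv v5)] -/
private theorem wB2_edges_not_mem (hC : CorrB E) : ∀ f ∈ wB2.edges.toFinset, f ∉ E := by
  intro f hf
  have : wB2.edges = [s(![0, 1], ![-1, 0]), s(![-1, 0], ![0, -1]), s(![0, -1], ![1, 0]), s(![1, 0], ![2, 1]),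
      s(![2, 1], ![1, 2])] := by decide
  rw [this] at hf
  simp only [List.toFinset_cons, List.toFinset_nil, Finset.mem_insert, Finset.notMem_empty, or_false] at hf
  rcases hf with rfl | rfl | rfl | rfl | rfl
  · exact not_mem_of_endpoint (Or.inr (newB_not_vert hC (Or.inl rfl)))
  · exact not_mem_of_endpoint (Or.inl (newB_not_vert hC (Or.inl rfl)))
  · exact not_mem_of_endpoint (Or.inl (newB_not_vert hC (Or.inr (Or.inl rfl))))
  · exact not_mem_of_endpoint (Or.inl (newB_not_vert hC (Or.inr (Or.inr (Or.inl rfl)))))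
  · exact not_mem_of_endpoint (Or.inl (newB_not_vert hC (Or.inr (Or.inr (Or.inr rfl)))))

/-- **Branch legibility, type B**: the edge `(−2,1)–(−1,0)` is in `capB E` iff branch B1 applies. [cite: Madras1995LatticeAnimalsExponent, §2 (decoding the join)] -/
theorem capB_branch_iff (hC : CorrB E) :
    s((![-2, 1] : Site 2), ![-1, 0]) ∈ capB E ↔ s((![-2, 1] : Site 2), ![0, 1]) ∈ E := by
  classical
  unfold capB
  split_ifs with h
  · simp only [h, iff_true]
    exact Finset.mem_union_right _ (by rw [List.mem_toFinset]; decide)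
  · simp only [h, iff_false]
    intro hm
    rcases Finset.mem_union.1 hm with hm | hm
    · exact not_mem_of_right (newB_not_vert hC (Or.inl rfl)) (Finset.mem_of_mem_erase hm)
    · rw [List.mem_toFinset] at hm; revert hm; decide

/-- **Type B: the rule is injective** on polygons satisfying the type-B hypothesis. [cite: Madras1995LatticeAnimalsExponent, §2 (the join is injective)] -/
theorem capB_injective {E₁ E₂ : Finset (Sym2 (Site 2))} (hC₁ : CorrB E₁) (hC₂ : CorrB E₂)
    (ht₁ : (![0, 1] : Site 2) ∈ vertsOf E₁) (ht₂ : (![0, 1] : Site 2) ∈ vertsOf E₂)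
    (hE₁ : IsPolygon brickGraph E₁) (hE₂ : IsPolygon brickGraph E₂) (h : capB E₁ = capB E₂) : E₁ = E₂ := by
  classical
  have hb : (s((![-2, 1] : Site 2), ![0, 1]) ∈ E₁) ↔ (s((![-2, 1] : Site 2), ![0, 1]) ∈ E₂) := by
    rw [← capB_branch_iff hC₁, ← capB_branch_iff hC₂, h]
  by_cases h1 : s((![-2, 1] : Site 2), ![0, 1]) ∈ E₁
  · have h2 := hb.1 h1
    have c1 : capB E₁ = E₁.erase s((![-2, 1] : Site 2), ![0, 1]) ∪ wB1.edges.toFinset := by unfold capB; rw [if_pos h1]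
    have c2 : capB E₂ = E₂.erase s((![-2, 1] : Site 2), ![0, 1]) ∪ wB1.edges.toFinset := by unfold capB; rw [if_pos h2]
    rw [← reroute_undo wB1 h1 (wB1_edges_not_mem hC₁), ← reroute_undo wB1 h2 (wB1_edges_not_mem hC₂), ← c1, ← c2, h]
  · have h2 : s((![-2, 1] : Site 2), ![0, 1]) ∉ E₂ := fun h' => h1 (hb.2 h')
    have s1 := ne_edge_of_not_w hE₁ hC₁ ht₁ h1
    have s2 := ne_edge_of_not_w hE₂ hC₂ ht₂ h2
    have c1 : capB E₁ = E₁.erase s((![0, 1] : Site 2), ![1, 2]) ∪ wB2.edges.toFinset := by unfold capB; rw [if_neg h1]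
    have c2 : capB E₂ = E₂.erase s((![0, 1] : Site 2), ![1, 2]) ∪ wB2.edges.toFinset := by unfold capB; rw [if_neg h2]
    rw [← reroute_undo wB2 s1 (wB2_edges_not_mem hC₁), ← reroute_undo wB2 s2 (wB2_edges_not_mem hC₂), ← c1, ← c2, h]

end TypeB

/-! ### (5) TYPE C: a diagonal contact `t = 0` with partner `w = (1,−1)` -/

section TypeC

/-- **Type-C hypothesis at `t = 0`** (partner `w = (1,−1)` below-right in the other polygon; this is the INTERSECTION of what
`le_of_isFirstContact` gives for the left polygon and — after the π-rotation about the pair's centre — for the right one, so the same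
rule serves both): every vertex of `E` in the rows `−3, …, 1` has `X ≤ 1`, and `(1,−1)` is not a vertex of `E` (no shared site).
(Parity then gives `X ≤ 0` in the rows `0, −2`.) [cite: Hammond2015SAPJoining, §4.1 p. 18 (arXiv v5): the empty right corridor] -/
def CorrC (E : Finset (Sym2 (Site 2))) : Prop :=
  (∀ v ∈ vertsOf E, -3 ≤ v 1 → v 1 ≤ 1 → v 0 ≤ 1) ∧ (![1, -1] : Site 2) ∉ vertsOf E

/-- C1: `0 → (1,−1) → (3,−1) → (4,0) → (3,1) → (1,1)` (replaces the edge `0–(1,1)`). [cite: Madras1995LatticeAnimalsExponent, §2; Hammond2015SAPJoining, §4.1 p. 18 (arXiv v5)] -/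
def wC1 : brickGraph.Walk (![0, 0] : Site 2) ![1, 1] :=
  Walk.cons (v := ![1, -1]) (by decide) <| Walk.cons (v := ![3, -1]) (by decide) <| Walk.cons (v := ![4, 0]) (by decide) <|
  Walk.cons (v := ![3, 1]) (by decide) <| Walk.cons (v := ![1, 1]) (by decide) Walk.nil
/-- C2 = A1's detour: `(−1,1) → (1,1) → (3,1) → (2,0) → (1,−1) → 0`. [cite: Madras1995LatticeAnimalsExponent, §2; Hammond2015SAPJoining, §4.1 p. 18 (arXiv v5)] -/
def wC2 : brickGraph.Walk (![-1, 1] : Site 2) ![0, 0] := wA1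
/-- C3 = A2's detour: `(−1,−1) → (1,−1) → (2,0) → (3,1) → (1,1) → 0`. [cite: Madras1995LatticeAnimalsExponent, §2; Hammond2015SAPJoining, §4.1 p. 18 (arXiv v5)] -/
def wC3 : brickGraph.Walk (![-1, -1] : Site 2) ![0, 0] := wA2
/-- C4: `(−1,−1) → (1,−1) → (3,−1) → (4,0) → (2,0) → 0` (replaces `(−1,−1)–0`; used when `(1,1)` is a vertex of `E`). [cite: Madras1995LatticeAnimalsExponent, §2; Hammond2015SAPJoining, §4.1 p. 18 (arXiv v5)] -/
def wC4 : brickGraph.Walk (![-1, -1] : Site 2) ![0, 0] :=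
  Walk.cons (v := ![1, -1]) (by decide) <| Walk.cons (v := ![3, -1]) (by decide) <| Walk.cons (v := ![4, 0]) (by decide) <|
  Walk.cons (v := ![2, 0]) (by decide) <| Walk.cons (v := ![0, 0]) (by decide) Walk.nil
/-- C5: `0 → (1,−1) → (3,−1) → (4,0) → (3,1) → (2,0) → (1,1)` (replaces the two-edge path `0–(−1,1)–(1,1)`, DROPPING the site `(−1,1)`;
cf. Madras' `ℤ²` rule "two edges are removed and ten added"). [cite: Madras1995LatticeAnimalsExponent, §2; Hammond2015SAPJoining, §4.1 p. 18 (arXiv v5)] -/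
def wC5 : brickGraph.Walk (![0, 0] : Site 2) ![1, 1] :=
  Walk.cons (v := ![1, -1]) (by decide) <| Walk.cons (v := ![3, -1]) (by decide) <| Walk.cons (v := ![4, 0]) (by decide) <|
  Walk.cons (v := ![3, 1]) (by decide) <| Walk.cons (v := ![2, 0]) (by decide) <| Walk.cons (v := ![1, 1]) (by decide) Walk.nil
/-- C6: `(1,1) → (2,0) → (3,−1) → (4,0) → (3,1) → (2,2)` (replaces the edge `(1,1)–(2,2)`). [cite: Madras1995LatticeAnimalsExponent, §2; Hammond2015SAPJoining, §4.1 p. 18 (arXiv v5)] -/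
def wC6 : brickGraph.Walk (![1, 1] : Site 2) ![2, 2] :=
  Walk.cons (v := ![2, 0]) (by decide) <| Walk.cons (v := ![3, -1]) (by decide) <| Walk.cons (v := ![4, 0]) (by decide) <|
  Walk.cons (v := ![3, 1]) (by decide) <| Walk.cons (v := ![2, 2]) (by decide) Walk.nil

/-- `wC1` is self-avoiding. [folklore] -/ private theorem wC1_isPath : wC1.IsPath := by rw [Walk.isPath_def]; decide
/-- `wC4` is self-avoiding. [folklore] -/ private theorem wC4_isPath : wC4.IsPath := by rw [Walk.isPath_def]; decide
/-- `wC5` is self-avoiding. [folklore] -/ private theorem wC5_isPath : wC5.IsPath := by rw [Walk.isPath_def]; decide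
/-- `wC6` is self-avoiding. [folklore] -/ private theorem wC6_isPath : wC6.IsPath := by rw [Walk.isPath_def]; decide
/-- `wC1` has length 5. [folklore] -/ private theorem wC1_length : wC1.length = 5 := by decide
/-- `wC4` has length 5. [folklore] -/ private theorem wC4_length : wC4.length = 5 := by decide
/-- `wC5` has length 6. [folklore] -/ private theorem wC5_length : wC5.length = 6 := by decide
/-- `wC6` has length 5. [folklore] -/ private theorem wC6_length : wC6.length = 5 := by decide
/-- `wC2` is self-avoiding. [folklore] -/ private theorem wC2_isPath : wC2.IsPath := wA1_isPath
/-- `wC3` is self-avoiding. [folklore] -/ private theorem wC3_isPath : wC3.IsPath := wA2_isPath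
/-- `wC2` has length 5. [folklore] -/ private theorem wC2_length : wC2.length = 5 := wA1_length
/-- `wC3` has length 5. [folklore] -/ private theorem wC3_length : wC3.length = 5 := wA2_length
/-- the sites of `wC2`. [folklore] -/
private theorem wC2_support : wC2.support = [![-1, 1], ![1, 1], ![3, 1], ![2, 0], ![1, -1], ![0, 0]] := wA1_support
/-- the sites of `wC3`. [folklore] -/
private theorem wC3_support : wC3.support = [![-1, -1], ![1, -1], ![2, 0], ![3, 1], ![1, 1], ![0, 0]] := wA2_support
/-- the sites of `wC1`. [folklore] -/
private theorem wC1_support : wC1.support = [![0, 0], ![1, -1], ![3, -1], ![4, 0], ![3, 1], ![1, 1]] := by decide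
/-- the sites of `wC4`. [folklore] -/
private theorem wC4_support : wC4.support = [![-1, -1], ![1, -1], ![3, -1], ![4, 0], ![2, 0], ![0, 0]] := by decide
/-- the sites of `wC5`. [folklore] -/
private theorem wC5_support : wC5.support = [![0, 0], ![1, -1], ![3, -1], ![4, 0], ![3, 1], ![2, 0], ![1, 1]] := by decide
/-- the sites of `wC6`. [folklore] -/
private theorem wC6_support : wC6.support = [![1, 1], ![2, 0], ![3, -1], ![4, 0], ![3, 1], ![2, 2]] := by decide

/-- The corridor sites `(1,−1), (3,−1), (4,0), (2,0), (3,1)` used by the type-C detours are not vertices of `E` under `CorrC`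
(`(1,1)` is NOT among them: it may be a vertex of `E`). [cite: Hammond2015SAPJoining, §4.1 p. 18 (arXiv v5)] -/
private theorem newC_not_vert (hC : CorrC E) {x : Site 2}
    (hx : x = ![1, -1] ∨ x = ![3, -1] ∨ x = ![4, 0] ∨ x = ![2, 0] ∨ x = ![3, 1]) : x ∉ vertsOf E := by
  obtain ⟨hrow, h11⟩ := hC
  rcases hx with rfl | rfl | rfl | rfl | rfl
  · exact h11
  all_goals
    intro hv
    have h := hrow _ hv (by simp) (by simp)
    simp at h

open Classical in
/-- **The type-C rule at `t = 0`** (six branches, first match wins; see the design note's table):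
C1 `0–(1,1) ∈ E`; C2 `(1,1) ∉ E`, `(−1,1)–0 ∈ E`; C3 `(1,1) ∉ E` otherwise; C4 `(1,1) ∈ E` (not via `0`), `(−1,−1)–0 ∈ E`;
C5 `(−1,1)–(1,1) ∈ E` (then `0–(−1,1) ∈ E`; the site `(−1,1)` is dropped); C6 otherwise (`(1,1)–(2,2) ∈ E`).
[cite: Madras1995LatticeAnimalsExponent, §2; Hammond2015SAPJoining, §4.1 p. 18 (arXiv v5)] -/
def capC (E : Finset (Sym2 (Site 2))) : Finset (Sym2 (Site 2)) :=
  if s((![0, 0] : Site 2), ![1, 1]) ∈ E then E.erase s((![0, 0] : Site 2), ![1, 1]) ∪ wC1.edges.toFinset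
  else if (![1, 1] : Site 2) ∈ vertsOf E then
    (if s((![-1, -1] : Site 2), ![0, 0]) ∈ E then E.erase s((![-1, -1] : Site 2), ![0, 0]) ∪ wC4.edges.toFinset
     else if s((![-1, 1] : Site 2), ![1, 1]) ∈ E then
       (E.erase s((![0, 0] : Site 2), ![-1, 1])).erase s((![-1, 1] : Site 2), ![1, 1]) ∪ wC5.edges.toFinset
     else E.erase s((![1, 1] : Site 2), ![2, 2]) ∪ wC6.edges.toFinset)
  else if s((![-1, 1] : Site 2), ![0, 0]) ∈ E then E.erase s((![-1, 1] : Site 2), ![0, 0]) ∪ wC2.edges.toFinset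
  else E.erase s((![-1, -1] : Site 2), ![0, 0]) ∪ wC3.edges.toFinset

/-- Under `CorrC`, the `E`-neighbours of `0` are among `(−2,0), (−1,1), (−1,−1), (1,1)`. [cite: Hammond2015SAPJoining, §4.1 p. 18 (arXiv v5)] -/
private theorem nbr_zero_casesC (hE : IsPolygon brickGraph E) (hC : CorrC E) {w : Site 2} (hw : s((![0, 0] : Site 2), w) ∈ E) :
    w = ![-2, 0] ∨ w = ![-1, 1] ∨ w = ![-1, -1] ∨ w = ![1, 1] := by
  have ha := (brickGraph_adj_iff _ _).1 (adj_of_mem hE hw)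
  have hv : w ∈ vertsOf E := mem_vertsOf.2 ⟨_, hw, Sym2.mem_mk_right _ _⟩
  obtain ⟨hrow, h11⟩ := hC
  have hc := hrow w hv
  have hne : w ≠ ![1, -1] := fun h => h11 (h ▸ hv)
  rw [Ne, site_ext_iff] at hne
  simp only [vec_zero', vec_one'] at ha hne
  rcases ha with ⟨h1, h0⟩ | ⟨h1, h0⟩
  · have : w 0 ≤ 1 := hc (by omega) (by omega)
    left; rw [site_ext_iff]; simp; omega
  · have : w 0 ≤ 1 := hc (by omega) (by omega)
    rcases h1 with h1 | h1 <;> rcases h0 with h0 | h0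
    · right; right; right; rw [site_ext_iff]; simp; omega
    · right; left; rw [site_ext_iff]; simp; omega
    · exfalso; omega
    · right; right; left; rw [site_ext_iff]; simp; omega

/-- Under `CorrC`, the `E`-neighbours of `(1,1)` are among `0, (−1,1), (0,2), (2,2)`. [cite: Hammond2015SAPJoining, §4.1 p. 18 (arXiv v5)] -/
private theorem nbr_11_cases (hE : IsPolygon brickGraph E) (hC : CorrC E) {w : Site 2} (hw : s((![1, 1] : Site 2), w) ∈ E) :
    w = ![0, 0] ∨ w = ![-1, 1] ∨ w = ![0, 2] ∨ w = ![2, 2] := by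
  have ha := (brickGraph_adj_iff _ _).1 (adj_of_mem hE hw)
  have hv : w ∈ vertsOf E := mem_vertsOf.2 ⟨_, hw, Sym2.mem_mk_right _ _⟩
  obtain ⟨hrow, -⟩ := hC
  have hc := hrow w hv
  simp only [vec_zero', vec_one'] at ha
  rcases ha with ⟨h1, h0⟩ | ⟨h1, h0⟩
  · have : w 0 ≤ 1 := hc (by omega) (by omega)
    right; left; rw [site_ext_iff]; simp; omega
  · rcases h1 with h1 | h1 <;> rcases h0 with h0 | h0
    · right; right; right; rw [site_ext_iff]; simp; omega
    · right; right; left; rw [site_ext_iff]; simp; omega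
    · have : w 0 ≤ 1 := hc (by omega) (by omega)
      exfalso; omega
    · left; rw [site_ext_iff]; simp; omega

/-- Branch facts, C3: if `(1,1)–0 ∉ E` and `(−1,1)–0 ∉ E` then `(−1,−1)–0 ∈ E` (for `0 ∈ E`). [cite: Hammond2015SAPJoining, §4.1 p. 18 (arXiv v5)] -/
private theorem sw_edge_C (hE : IsPolygon brickGraph E) (hC : CorrC E) (h0 : (![0, 0] : Site 2) ∈ vertsOf E)
    (hne : s((![0, 0] : Site 2), ![1, 1]) ∉ E) (hnw : s((![-1, 1] : Site 2), ![0, 0]) ∉ E) :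
    s((![-1, -1] : Site 2), ![0, 0]) ∈ E := by
  obtain ⟨w₁, w₂, hne12, h₁, h₂, -, -⟩ := two_nbrs hE h0
  have hnw' : ∀ w, s((![0, 0] : Site 2), w) ∈ E → w ≠ ![-1, 1] := by
    rintro w hw rfl; rw [Sym2.eq_swap] at hw; exact hnw hw
  have hne' : ∀ w, s((![0, 0] : Site 2), w) ∈ E → w ≠ ![1, 1] := by
    rintro w hw rfl; exact hne hw
  rcases nbr_zero_casesC hE hC h₁ with e₁ | e₁ | e₁ | e₁ <;> rcases nbr_zero_casesC hE hC h₂ with e₂ | e₂ | e₂ | e₂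
  all_goals first
    | exact absurd (e₁.trans e₂.symm) hne12
    | exact absurd e₁ (hnw' _ h₁)
    | exact absurd e₂ (hnw' _ h₂)
    | exact absurd e₁ (hne' _ h₁)
    | exact absurd e₂ (hne' _ h₂)
    | (rw [Sym2.eq_swap, ← e₁]; exact h₁)
    | (rw [Sym2.eq_swap, ← e₂]; exact h₂)

/-- Branch facts, C5/C6: if `(1,1)–0 ∉ E` and `(−1,−1)–0 ∉ E` then `0–(−1,1) ∈ E` (for `0 ∈ E`). [cite: Hammond2015SAPJoining, §4.1 p. 18 (arXiv v5)] -/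
private theorem nw_edge_C (hE : IsPolygon brickGraph E) (hC : CorrC E) (h0 : (![0, 0] : Site 2) ∈ vertsOf E)
    (hne : s((![0, 0] : Site 2), ![1, 1]) ∉ E) (hsw : s((![-1, -1] : Site 2), ![0, 0]) ∉ E) :
    s((![0, 0] : Site 2), ![-1, 1]) ∈ E := by
  obtain ⟨w₁, w₂, hne12, h₁, h₂, -, -⟩ := two_nbrs hE h0
  have hsw' : ∀ w, s((![0, 0] : Site 2), w) ∈ E → w ≠ ![-1, -1] := by
    rintro w hw rfl; rw [Sym2.eq_swap] at hw; exact hsw hw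
  have hne' : ∀ w, s((![0, 0] : Site 2), w) ∈ E → w ≠ ![1, 1] := by
    rintro w hw rfl; exact hne hw
  rcases nbr_zero_casesC hE hC h₁ with e₁ | e₁ | e₁ | e₁ <;> rcases nbr_zero_casesC hE hC h₂ with e₂ | e₂ | e₂ | e₂
  all_goals first
    | exact absurd (e₁.trans e₂.symm) hne12
    | exact absurd e₁ (hsw' _ h₁)
    | exact absurd e₂ (hsw' _ h₂)
    | exact absurd e₁ (hne' _ h₁)
    | exact absurd e₂ (hne' _ h₂)
    | (rw [← e₁]; exact h₁)
    | (rw [← e₂]; exact h₂)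

/-- Branch facts, C6: if `0–(1,1) ∉ E`, `(−1,1)–(1,1) ∉ E` and `(1,1) ∈ E` then `(1,1)–(2,2) ∈ E`. [cite: Hammond2015SAPJoining, §4.1 p. 18 (arXiv v5)] -/
private theorem ne_edge_C6 (hE : IsPolygon brickGraph E) (hC : CorrC E) (h11 : (![1, 1] : Site 2) ∈ vertsOf E)
    (hne : s((![0, 0] : Site 2), ![1, 1]) ∉ E) (h5 : s((![-1, 1] : Site 2), ![1, 1]) ∉ E) :
    s((![1, 1] : Site 2), ![2, 2]) ∈ E := by
  obtain ⟨w₁, w₂, hne12, h₁, h₂, -, -⟩ := two_nbrs hE h11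
  have ha : ∀ w, s((![1, 1] : Site 2), w) ∈ E → w ≠ ![0, 0] := by
    rintro w hw rfl; rw [Sym2.eq_swap] at hw; exact hne hw
  have hb : ∀ w, s((![1, 1] : Site 2), w) ∈ E → w ≠ ![-1, 1] := by
    rintro w hw rfl; rw [Sym2.eq_swap] at hw; exact h5 hw
  rcases nbr_11_cases hE hC h₁ with e₁ | e₁ | e₁ | e₁ <;> rcases nbr_11_cases hE hC h₂ with e₂ | e₂ | e₂ | e₂
  all_goals first
    | exact absurd (e₁.trans e₂.symm) hne12
    | exact absurd e₁ (ha _ h₁)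
    | exact absurd e₂ (ha _ h₂)
    | exact absurd e₁ (hb _ h₁)
    | exact absurd e₂ (hb _ h₂)
    | (rw [← e₁]; exact h₁)
    | (rw [← e₂]; exact h₂)

/-- Branch facts, C5: the site `(−1,1)` has exactly the two `E`-neighbours `0` and `(1,1)` when both those edges are in `E`.
[cite: Hammond2015SAPJoining, §4.1 p. 18 (arXiv v5)] -/
private theorem m_only_C5 (hE : IsPolygon brickGraph E) (hum : s((![0, 0] : Site 2), ![-1, 1]) ∈ E)
    (hmv : s((![-1, 1] : Site 2), ![1, 1]) ∈ E) :
    ∀ w, s((![-1, 1] : Site 2), w) ∈ E → w = ![0, 0] ∨ w = ![1, 1] := by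
  intro w hw
  by_contra hnot
  push Not at hnot
  have hum' : s((![-1, 1] : Site 2), ![0, 0]) ∈ E := by rw [Sym2.eq_swap]; exact hum
  exact polygon_deg_le_two hE hum' hmv hw (by decide) (Ne.symm hnot.1) (Ne.symm hnot.2)

/-- **Type C: the capped edge set is a brick polygon with four more edges.**
[cite: Madras1995LatticeAnimalsExponent, §2; Hammond2015SAPJoining, §4.1 p. 18 (arXiv v5)] -/
theorem capC_isPolygon_card (hE : IsPolygon brickGraph E) (hC : CorrC E) (h0 : (![0, 0] : Site 2) ∈ vertsOf E) :
    IsPolygon brickGraph (capC E) ∧ (capC E).card = E.card + 4 := by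
  classical
  -- interior-avoidance for each detour
  have hintOf : ∀ {u v : Site 2} (A : brickGraph.Walk u v) (L : List (Site 2)),
      A.support = u :: L → (∀ x ∈ L, x ≠ v → x ∉ vertsOf E) →
      ∀ x ∈ A.support, x ≠ u → x ≠ v → ∀ e ∈ E, x ∉ e := by
    intro u v A L hs hL x hx hxu hxv e he hxe
    rw [hs] at hx
    rcases List.mem_cons.1 hx with rfl | hx
    · exact hxu rfl
    · exact hL x hx hxv (mem_vertsOf.2 ⟨e, he, hxe⟩)
  unfold capC
  split_ifs with h1 h11 h4 h5 h2
  · -- C1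
    have hint := hintOf wC1 _ wC1_support (by
      intro x hx hxv
      simp only [List.mem_cons, List.not_mem_nil, or_false] at hx
      rcases hx with rfl | rfl | rfl | rfl | rfl
      · exact newC_not_vert hC (Or.inl rfl)
      · exact newC_not_vert hC (Or.inr (Or.inl rfl))
      · exact newC_not_vert hC (Or.inr (Or.inr (Or.inl rfl)))
      · exact newC_not_vert hC (Or.inr (Or.inr (Or.inr (Or.inr rfl))))
      · exact absurd rfl hxv)
    obtain ⟨hP, hc⟩ := reroute_one hE h1 wC1_isPath (by rw [wC1_length]; omega) hint
    exact ⟨hP, by rw [wC1_length] at hc; omega⟩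
  · -- C4
    have hint := hintOf wC4 _ wC4_support (by
      intro x hx hxv
      simp only [List.mem_cons, List.not_mem_nil, or_false] at hx
      rcases hx with rfl | rfl | rfl | rfl | rfl
      · exact newC_not_vert hC (Or.inl rfl)
      · exact newC_not_vert hC (Or.inr (Or.inl rfl))
      · exact newC_not_vert hC (Or.inr (Or.inr (Or.inl rfl)))
      · exact newC_not_vert hC (Or.inr (Or.inr (Or.inr (Or.inl rfl))))
      · exact absurd rfl hxv)
    obtain ⟨hP, hc⟩ := reroute_one hE h4 wC4_isPath (by rw [wC4_length]; omega) hint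
    exact ⟨hP, by rw [wC4_length] at hc; omega⟩
  · -- C5
    have hum := nw_edge_C hE hC h0 h1 h4
    have hint := hintOf wC5 _ wC5_support (by
      intro x hx hxv
      simp only [List.mem_cons, List.not_mem_nil, or_false] at hx
      rcases hx with rfl | rfl | rfl | rfl | rfl | rfl
      · exact newC_not_vert hC (Or.inl rfl)
      · exact newC_not_vert hC (Or.inr (Or.inl rfl))
      · exact newC_not_vert hC (Or.inr (Or.inr (Or.inl rfl)))
      · exact newC_not_vert hC (Or.inr (Or.inr (Or.inr (Or.inr rfl))))
      · exact newC_not_vert hC (Or.inr (Or.inr (Or.inr (Or.inl rfl))))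
      · exact absurd rfl hxv)
    obtain ⟨hP, hc⟩ := reroute_two hE hum h5 (by decide) (m_only_C5 hE hum h5) wC5_isPath
      (by rw [wC5_length]; omega) hint
    exact ⟨hP, by rw [wC5_length] at hc; omega⟩
  · -- C6
    have h6 := ne_edge_C6 hE hC h11 h1 h5
    have hint := hintOf wC6 _ wC6_support (by
      intro x hx hxv
      simp only [List.mem_cons, List.not_mem_nil, or_false] at hx
      rcases hx with rfl | rfl | rfl | rfl | rfl
      · exact newC_not_vert hC (Or.inr (Or.inr (Or.inr (Or.inl rfl))))
      · exact newC_not_vert hC (Or.inr (Or.inl rfl))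
      · exact newC_not_vert hC (Or.inr (Or.inr (Or.inl rfl)))
      · exact newC_not_vert hC (Or.inr (Or.inr (Or.inr (Or.inr rfl))))
      · exact absurd rfl hxv)
    obtain ⟨hP, hc⟩ := reroute_one hE h6 wC6_isPath (by rw [wC6_length]; omega) hint
    exact ⟨hP, by rw [wC6_length] at hc; omega⟩
  · -- C2
    have hint := hintOf wC2 _ wC2_support (by
      intro x hx hxv
      simp only [List.mem_cons, List.not_mem_nil, or_false] at hx
      rcases hx with rfl | rfl | rfl | rfl | rfl
      · exact h11
      · exact newC_not_vert hC (Or.inr (Or.inr (Or.inr (Or.inr rfl))))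
      · exact newC_not_vert hC (Or.inr (Or.inr (Or.inr (Or.inl rfl))))
      · exact newC_not_vert hC (Or.inl rfl)
      · exact absurd rfl hxv)
    obtain ⟨hP, hc⟩ := reroute_one hE h2 wC2_isPath (by rw [wC2_length]; omega) hint
    exact ⟨hP, by rw [wC2_length] at hc; omega⟩
  · -- C3
    have h3 := sw_edge_C hE hC h0 h1 h2
    have hint := hintOf wC3 _ wC3_support (by
      intro x hx hxv
      simp only [List.mem_cons, List.not_mem_nil, or_false] at hx
      rcases hx with rfl | rfl | rfl | rfl | rfl
      · exact newC_not_vert hC (Or.inl rfl)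
      · exact newC_not_vert hC (Or.inr (Or.inr (Or.inr (Or.inl rfl))))
      · exact newC_not_vert hC (Or.inr (Or.inr (Or.inr (Or.inr rfl))))
      · exact h11
      · exact absurd rfl hxv)
    obtain ⟨hP, hc⟩ := reroute_one hE h3 wC3_isPath (by rw [wC3_length]; omega) hint
    exact ⟨hP, by rw [wC3_length] at hc; omega⟩

/-- The junction site of the type-C rule: `(1,−1)` in branches C2/C3 (line `X − Y = 2`), `(3,−1)` otherwise (line `X − Y = 4`).
[cite: Hammond2015SAPJoining, §4.1 p. 18 (arXiv v5): "extends … by either two or three units inside the right corridor"] -/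
def juncC (E : Finset (Sym2 (Site 2))) : Site 2 :=
  if s((![0, 0] : Site 2), ![1, 1]) ∈ E ∨ (![1, 1] : Site 2) ∈ vertsOf E then ![3, -1] else ![1, -1]

/-- **Type C: the junction NE-edge `juncC – juncC + (1,1)` (rows `−1, 0`) lies in the capped polygon.**
[cite: Hammond2015SAPJoining, §4.1 p. 18 (arXiv v5)] -/
theorem ne_edge_capC (E : Finset (Sym2 (Site 2))) :
    s(juncC E, juncC E + ![1, 1]) ∈ capC E := by
  classical
  have e1 : (![1, -1] : Site 2) + ![1, 1] = ![2, 0] := by funext i; fin_cases i <;> rfl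
  have e3 : (![3, -1] : Site 2) + ![1, 1] = ![4, 0] := by funext i; fin_cases i <;> rfl
  by_cases h1 : s((![0, 0] : Site 2), ![1, 1]) ∈ E
  · rw [juncC, if_pos (Or.inl h1), e3, capC, if_pos h1]
    exact Finset.mem_union_right _ (by rw [List.mem_toFinset]; decide)
  by_cases h11 : (![1, 1] : Site 2) ∈ vertsOf E
  · rw [juncC, if_pos (Or.inr h11), e3, capC, if_neg h1, if_pos h11]
    by_cases h4 : s((![-1, -1] : Site 2), ![0, 0]) ∈ E
    · rw [if_pos h4]; exact Finset.mem_union_right _ (by rw [List.mem_toFinset]; decide)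
    rw [if_neg h4]
    by_cases h5 : s((![-1, 1] : Site 2), ![1, 1]) ∈ E
    · rw [if_pos h5]; exact Finset.mem_union_right _ (by rw [List.mem_toFinset]; decide)
    · rw [if_neg h5]; exact Finset.mem_union_right _ (by rw [List.mem_toFinset]; decide)
  · have hno : ¬ (s((![0, 0] : Site 2), ![1, 1]) ∈ E ∨ (![1, 1] : Site 2) ∈ vertsOf E) := by
      rintro (h | h); exacts [h1 h, h11 h]
    rw [juncC, if_neg hno, e1, capC, if_neg h1, if_neg h11]
    by_cases h2 : s((![-1, 1] : Site 2), ![0, 0]) ∈ E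
    · rw [if_pos h2]; exact Finset.mem_union_right _ (by rw [List.mem_toFinset]; decide)
    · rw [if_neg h2]; exact Finset.mem_union_right _ (by rw [List.mem_toFinset]; decide)

/-- **Type C: the vertices of the capped polygon** are vertices of `E` or among the six corridor/window sites
`(1,−1), (3,−1), (4,0), (2,0), (3,1), (1,1)`. [cite: Hammond2015SAPJoining, §4.1 p. 18 (arXiv v5)] -/
theorem vertsOf_capC_subset {x : Site 2} (hx : x ∈ vertsOf (capC E)) :
    x ∈ vertsOf E ∨ (x = ![1, -1] ∨ x = ![3, -1] ∨ x = ![4, 0] ∨ x = ![2, 0] ∨ x = ![3, 1] ∨ x = ![1, 1] ∨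
      x = ![0, 0] ∨ x = ![-1, 1] ∨ x = ![-1, -1] ∨ x = ![2, 2]) := by
  classical
  unfold capC at hx
  split_ifs at hx
  · rcases vertsOf_reroute_subset wC1 hx with h | h
    · exact Or.inl h
    · rw [wC1_support] at h; simp only [List.mem_cons, List.not_mem_nil, or_false] at h
      rcases h with rfl | rfl | rfl | rfl | rfl | rfl <;> simp
  · rcases vertsOf_reroute_subset wC4 hx with h | h
    · exact Or.inl h
    · rw [wC4_support] at h; simp only [List.mem_cons, List.not_mem_nil, or_false] at h
      rcases h with rfl | rfl | rfl | rfl | rfl | rfl <;> simp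
  · rcases vertsOf_reroute₂_subset wC5 hx with h | h
    · exact Or.inl h
    · rw [wC5_support] at h; simp only [List.mem_cons, List.not_mem_nil, or_false] at h
      rcases h with rfl | rfl | rfl | rfl | rfl | rfl | rfl <;> simp
  · rcases vertsOf_reroute_subset wC6 hx with h | h
    · exact Or.inl h
    · rw [wC6_support] at h; simp only [List.mem_cons, List.not_mem_nil, or_false] at h
      rcases h with rfl | rfl | rfl | rfl | rfl | rfl <;> simp
  · rcases vertsOf_reroute_subset wC2 hx with h | h
    · exact Or.inl h
    · rw [wC2_support] at h; simp only [List.mem_cons, List.not_mem_nil, or_false] at h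
      rcases h with rfl | rfl | rfl | rfl | rfl | rfl <;> simp
  · rcases vertsOf_reroute_subset wC3 hx with h | h
    · exact Or.inl h
    · rw [wC3_support] at h; simp only [List.mem_cons, List.not_mem_nil, or_false] at h
      rcases h with rfl | rfl | rfl | rfl | rfl | rfl <;> simp

/-- **Type C, frontier of the new sites**: a vertex of `capC E` that is not a vertex of `E` lies in the rows `−1, 0, 1`, has
`X ≥ 1`, and lies on or left of the line `X − Y = juncC E 0 − juncC E 1` (`= 2` or `4`) through the junction edge.
[cite: Hammond2015SAPJoining, §4.1 p. 18 (arXiv v5)] -/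
theorem new_vert_capC (hE : IsPolygon brickGraph E) (hC : CorrC E) (h0 : (![0, 0] : Site 2) ∈ vertsOf E)
    {x : Site 2} (hx : x ∈ vertsOf (capC E)) (hnew : x ∉ vertsOf E) :
    -1 ≤ x 1 ∧ x 1 ≤ 1 ∧ 1 ≤ x 0 ∧ x 0 - x 1 ≤ juncC E 0 - juncC E 1 := by
  classical
  have hj : juncC E 0 - juncC E 1 = 2 ∨ juncC E 0 - juncC E 1 = 4 := by
    unfold juncC; split_ifs <;> simp
  have hj4 : ¬ (s((![0, 0] : Site 2), ![1, 1]) ∉ E ∧ (![1, 1] : Site 2) ∉ vertsOf E) → juncC E 0 - juncC E 1 = 4 := by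
    intro h; unfold juncC; rw [if_pos (by tauto)]; simp
  have hj2 : (s((![0, 0] : Site 2), ![1, 1]) ∉ E ∧ (![1, 1] : Site 2) ∉ vertsOf E) → juncC E 0 - juncC E 1 = 2 := by
    intro h; unfold juncC; rw [if_neg (by tauto)]; simp
  -- the new sites per branch
  unfold capC at hx
  split_ifs at hx with h1 h11 h4 h5 h2
  · have := hj4 (fun h => h.1 h1)
    rcases vertsOf_reroute_subset wC1 hx with h | h
    · exact absurd h hnew
    rw [wC1_support] at h; simp only [List.mem_cons, List.not_mem_nil, or_false] at h
    rcases h with rfl | rfl | rfl | rfl | rfl | rfl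
    · exact absurd h0 hnew
    all_goals (first | exact absurd (mem_vertsOf.2 ⟨_, h1, Sym2.mem_mk_right _ _⟩) hnew | (simp; omega))
  · have := hj4 (fun h => h.2 h11)
    rcases vertsOf_reroute_subset wC4 hx with h | h
    · exact absurd h hnew
    rw [wC4_support] at h; simp only [List.mem_cons, List.not_mem_nil, or_false] at h
    rcases h with rfl | rfl | rfl | rfl | rfl | rfl
    · exact absurd (mem_vertsOf.2 ⟨_, h4, Sym2.mem_mk_left _ _⟩) hnew
    all_goals (first | exact absurd h0 hnew | (simp; omega))
  · have := hj4 (fun h => h.2 h11)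
    rcases vertsOf_reroute₂_subset wC5 hx with h | h
    · exact absurd h hnew
    rw [wC5_support] at h; simp only [List.mem_cons, List.not_mem_nil, or_false] at h
    rcases h with rfl | rfl | rfl | rfl | rfl | rfl | rfl
    · exact absurd h0 hnew
    all_goals (first | exact absurd h11 hnew | (simp; omega))
  · have := hj4 (fun h => h.2 h11)
    rcases vertsOf_reroute_subset wC6 hx with h | h
    · exact absurd h hnew
    rw [wC6_support] at h; simp only [List.mem_cons, List.not_mem_nil, or_false] at h
    have h6 := ne_edge_C6 hE hC h11 h1 h5
    rcases h with rfl | rfl | rfl | rfl | rfl | rfl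
    · exact absurd h11 hnew
    · simp; omega
    · simp; omega
    · simp; omega
    · simp; omega
    · exact absurd (mem_vertsOf.2 ⟨_, h6, Sym2.mem_mk_right _ _⟩) hnew
  · have := hj2 ⟨h1, h11⟩
    rcases vertsOf_reroute_subset wC2 hx with h | h
    · exact absurd h hnew
    rw [wC2_support] at h; simp only [List.mem_cons, List.not_mem_nil, or_false] at h
    rcases h with rfl | rfl | rfl | rfl | rfl | rfl
    · exact absurd (mem_vertsOf.2 ⟨_, h2, Sym2.mem_mk_left _ _⟩) hnew
    all_goals (first | exact absurd h0 hnew | (simp; omega))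
  · have := hj2 ⟨h1, h11⟩
    rcases vertsOf_reroute_subset wC3 hx with h | h
    · exact absurd h hnew
    rw [wC3_support] at h; simp only [List.mem_cons, List.not_mem_nil, or_false] at h
    have h3 := sw_edge_C hE hC h0 h1 h2
    rcases h with rfl | rfl | rfl | rfl | rfl | rfl
    · exact absurd (mem_vertsOf.2 ⟨_, h3, Sym2.mem_mk_left _ _⟩) hnew
    · simp; omega
    · simp; omega
    · simp; omega
    · simp; omega
    · exact absurd h0 hnew

/-- **Type C: every vertex of `E` other than `(−1,1)` is still a vertex of the capped polygon** (branch C5 drops `(−1,1)`; the other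
branches drop nothing). [cite: Hammond2015SAPJoining, §4.1 p. 18 (arXiv v5): "two edges are removed and ten edges added"] -/
theorem vertsOf_subset_capC (hE : IsPolygon brickGraph E) {x : Site 2} (hx : x ∈ vertsOf E) (hxm : x ≠ ![-1, 1]) :
    x ∈ vertsOf (capC E) := by
  classical
  unfold capC
  split_ifs
  · exact vertsOf_subset_reroute hE wC1 hx
  · exact vertsOf_subset_reroute hE wC4 hx
  · -- C5: two edges through `(−1,1)` are erased; a vertex `x ≠ (−1,1)` keeps one of its two edges
    obtain ⟨w₁, w₂, hne, h₁, h₂, -, -⟩ := two_nbrs hE hx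
    have key : ∀ {w : Site 2}, s(x, w) ∈ E → s(x, w) ≠ s((![0, 0] : Site 2), ![-1, 1]) →
        s(x, w) ≠ s((![-1, 1] : Site 2), ![1, 1]) →
        x ∈ vertsOf ((E.erase s((![0, 0] : Site 2), ![-1, 1])).erase s((![-1, 1] : Site 2), ![1, 1]) ∪ wC5.edges.toFinset) := by
      intro w hw ha hb
      exact mem_vertsOf.2 ⟨_, Finset.mem_union_left _ (Finset.mem_erase.2 ⟨hb, Finset.mem_erase.2 ⟨ha, hw⟩⟩),
        Sym2.mem_mk_left _ _⟩
    -- which of x's two edges could be erased?  an erased edge through x ≠ (−1,1) forces x = 0 (first) or x = (1,1) (second)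
    by_cases ha₁ : s(x, w₁) = s((![0, 0] : Site 2), ![-1, 1])
    · -- then x = 0 and w₁ = (−1,1); the other edge s(x,w₂) is neither erased edge
      have hx0 : x = ![0, 0] := by
        rcases Sym2.eq_iff.1 ha₁ with ⟨h, -⟩ | ⟨h, -⟩
        · exact h
        · exact absurd h hxm
      have hw₁ : w₁ = ![-1, 1] := by
        rcases Sym2.eq_iff.1 ha₁ with ⟨-, h⟩ | ⟨h, -⟩
        · exact h
        · exact absurd h hxm
      refine key h₂ ?_ ?_
      · intro h
        rcases Sym2.eq_iff.1 h with ⟨-, h'⟩ | ⟨h', -⟩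
        · exact hne (hw₁.trans h'.symm)
        · exact hxm h'
      · intro h
        rcases Sym2.eq_iff.1 h with ⟨h', -⟩ | ⟨h', -⟩
        · exact hxm h'
        · rw [hx0] at h'; revert h'; decide
    · by_cases hb₁ : s(x, w₁) = s((![-1, 1] : Site 2), ![1, 1])
      · have hx1 : x = ![1, 1] := by
          rcases Sym2.eq_iff.1 hb₁ with ⟨h, -⟩ | ⟨h, -⟩
          · exact absurd h hxm
          · exact h
        have hw₁ : w₁ = ![-1, 1] := by
          rcases Sym2.eq_iff.1 hb₁ with ⟨h, -⟩ | ⟨-, h⟩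
          · exact absurd h hxm
          · exact h
        refine key h₂ ?_ ?_
        · intro h
          rcases Sym2.eq_iff.1 h with ⟨h', -⟩ | ⟨h', -⟩
          · rw [hx1] at h'; revert h'; decide
          · exact hxm h'
        · intro h
          rcases Sym2.eq_iff.1 h with ⟨h', -⟩ | ⟨-, h'⟩
          · exact hxm h'
          · exact hne (hw₁.trans h'.symm)
      · exact key h₁ ha₁ hb₁
  · exact vertsOf_subset_reroute hE wC6 hx
  · exact vertsOf_subset_reroute hE wC2 hx
  · exact vertsOf_subset_reroute hE wC3 hx

/-! #### Type C: branch legibility and injectivity -/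

/-- the six detours' edge lists. [folklore] -/
private theorem wC1_edges : wC1.edges = [s(![0, 0], ![1, -1]), s(![1, -1], ![3, -1]), s(![3, -1], ![4, 0]),
    s(![4, 0], ![3, 1]), s(![3, 1], ![1, 1])] := by decide
/-- `wC2`'s edges. [folklore] -/
private theorem wC2_edges : wC2.edges = [s(![-1, 1], ![1, 1]), s(![1, 1], ![3, 1]), s(![3, 1], ![2, 0]),
    s(![2, 0], ![1, -1]), s(![1, -1], ![0, 0])] := by decide
/-- `wC3`'s edges. [folklore] -/
private theorem wC3_edges : wC3.edges = [s(![-1, -1], ![1, -1]), s(![1, -1], ![2, 0]), s(![2, 0], ![3, 1]),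
    s(![3, 1], ![1, 1]), s(![1, 1], ![0, 0])] := by decide
/-- `wC4`'s edges. [folklore] -/
private theorem wC4_edges : wC4.edges = [s(![-1, -1], ![1, -1]), s(![1, -1], ![3, -1]), s(![3, -1], ![4, 0]),
    s(![4, 0], ![2, 0]), s(![2, 0], ![0, 0])] := by decide
/-- `wC5`'s edges. [folklore] -/
private theorem wC5_edges : wC5.edges = [s(![0, 0], ![1, -1]), s(![1, -1], ![3, -1]), s(![3, -1], ![4, 0]),
    s(![4, 0], ![3, 1]), s(![3, 1], ![2, 0]), s(![2, 0], ![1, 1])] := by decide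
/-- `wC6`'s edges. [folklore] -/
private theorem wC6_edges : wC6.edges = [s(![1, 1], ![2, 0]), s(![2, 0], ![3, -1]), s(![3, -1], ![4, 0]),
    s(![4, 0], ![3, 1]), s(![3, 1], ![2, 2])] := by decide

/-- Every detour edge of type C has an endpoint among the corridor sites `(1,−1), (3,−1), (4,0), (2,0), (3,1)`, hence is not in `E`.
[cite: Hammond2015SAPJoining, §4.1 p. 18 (arXiv v5)] -/
private theorem corridor_edge_not_mem (hC : CorrC E) {a b : Site 2}
    (h : (a = ![1, -1] ∨ a = ![3, -1] ∨ a = ![4, 0] ∨ a = ![2, 0] ∨ a = ![3, 1]) ∨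
      (b = ![1, -1] ∨ b = ![3, -1] ∨ b = ![4, 0] ∨ b = ![2, 0] ∨ b = ![3, 1])) : s(a, b) ∉ E := by
  rcases h with h | h
  · exact not_mem_of_left (newC_not_vert hC h)
  · exact not_mem_of_right (newC_not_vert hC h)

/-- membership of a NON-`E` edge in a one-edge reroute is membership in the detour. [folklore] -/
private theorem mem_reroute_iff {e f : Sym2 (Site 2)} {u v : Site 2} (A : brickGraph.Walk u v) (hf : f ∉ E) :
    f ∈ E.erase e ∪ A.edges.toFinset ↔ f ∈ A.edges := by
  rw [Finset.mem_union, List.mem_toFinset, Finset.mem_erase]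
  exact ⟨fun h => h.elim (fun h => absurd h.2 hf) id, fun h => Or.inr h⟩

/-- membership of a NON-`E` edge in a two-edge reroute is membership in the detour. [folklore] -/
private theorem mem_reroute₂_iff {e e' f : Sym2 (Site 2)} {u v : Site 2} (A : brickGraph.Walk u v) (hf : f ∉ E) :
    f ∈ (E.erase e).erase e' ∪ A.edges.toFinset ↔ f ∈ A.edges := by
  rw [Finset.mem_union, List.mem_toFinset, Finset.mem_erase, Finset.mem_erase]
  exact ⟨fun h => h.elim (fun h => absurd h.2.2 hf) id, fun h => Or.inr h⟩

open Classical in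
/-- **The type-C decoder**: reads the branch off five corridor edges of the capped polygon and restores `E`.
(`(2,0)–0` ⇒ C4; `(3,1)–(2,2)` ⇒ C6; `(3,−1)–(4,0)` with `(3,1)–(1,1)` ⇒ C1, without ⇒ C5; else `(1,−1)–0` ⇒ C2, otherwise C3.)
[cite: Madras1995LatticeAnimalsExponent, §2 (decoding the join)] -/
def recoverC (F : Finset (Sym2 (Site 2))) : Finset (Sym2 (Site 2)) :=
  if s((![2, 0] : Site 2), ![0, 0]) ∈ F then insert s((![-1, -1] : Site 2), ![0, 0]) (F \ wC4.edges.toFinset)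
  else if s((![3, 1] : Site 2), ![2, 2]) ∈ F then insert s((![1, 1] : Site 2), ![2, 2]) (F \ wC6.edges.toFinset)
  else if s((![3, -1] : Site 2), ![4, 0]) ∈ F then
    (if s((![3, 1] : Site 2), ![1, 1]) ∈ F then insert s((![0, 0] : Site 2), ![1, 1]) (F \ wC1.edges.toFinset)
     else insert s((![0, 0] : Site 2), ![-1, 1]) (insert s((![-1, 1] : Site 2), ![1, 1]) (F \ wC5.edges.toFinset)))
  else if s((![1, -1] : Site 2), ![0, 0]) ∈ F then insert s((![-1, 1] : Site 2), ![0, 0]) (F \ wC2.edges.toFinset)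
  else insert s((![-1, -1] : Site 2), ![0, 0]) (F \ wC3.edges.toFinset)

/-- **Type C: decoding** — `recoverC (capC E) = E`. [cite: Madras1995LatticeAnimalsExponent, §2 (the join is injective)] -/
theorem recoverC_capC (hE : IsPolygon brickGraph E) (hC : CorrC E) (h0 : (![0, 0] : Site 2) ∈ vertsOf E) :
    recoverC (capC E) = E := by
  classical
  -- the five probe edges are never in `E`
  have na : s((![2, 0] : Site 2), ![0, 0]) ∉ E := corridor_edge_not_mem hC (Or.inl (by simp))
  have nb : s((![3, 1] : Site 2), ![2, 2]) ∉ E := corridor_edge_not_mem hC (Or.inl (by simp))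
  have nc : s((![3, -1] : Site 2), ![4, 0]) ∉ E := corridor_edge_not_mem hC (Or.inl (by simp))
  have nd : s((![3, 1] : Site 2), ![1, 1]) ∉ E := corridor_edge_not_mem hC (Or.inl (by simp))
  have nf : s((![1, -1] : Site 2), ![0, 0]) ∉ E := corridor_edge_not_mem hC (Or.inl (by simp))
  -- detour edges avoid E
  have hA : ∀ {u v : Site 2} (A : brickGraph.Walk u v) (L : List (Sym2 (Site 2))), A.edges = L →
      (∀ f ∈ L, f ∉ E) → ∀ f ∈ A.edges.toFinset, f ∉ E := by
    intro u v A L hL hf f hfA; rw [List.mem_toFinset, hL] at hfA; exact hf f hfA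
  -- the detours C1, C4, C5, C6 use only edges with a corridor endpoint
  have avoid : ∀ f : Sym2 (Site 2), f ∈ wC1.edges ++ wC4.edges ++ wC5.edges ++ wC6.edges → f ∉ E := by
    intro f hf
    rw [wC1_edges, wC4_edges, wC5_edges, wC6_edges] at hf
    simp only [List.cons_append, List.nil_append, List.mem_cons, List.not_mem_nil, or_false] at hf
    rcases hf with rfl | rfl | rfl | rfl | rfl | rfl | rfl | rfl | rfl | rfl | rfl | rfl | rfl | rfl | rfl | rfl | rfl | rfl |
      rfl | rfl | rfl
    all_goals exact corridor_edge_not_mem hC (by decide)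
  have av : ∀ {u v : Site 2} (A : brickGraph.Walk u v),
      (∀ f, f ∈ A.edges → f ∈ wC1.edges ++ wC4.edges ++ wC5.edges ++ wC6.edges) →
      ∀ f ∈ A.edges.toFinset, f ∉ E := by
    intro u v A hsub f hf; rw [List.mem_toFinset] at hf; exact avoid f (hsub f hf)
  have av1 := av wC1 (fun f hf => by simp [hf])
  have av4 := av wC4 (fun f hf => by simp [hf])
  have av5 := av wC5 (fun f hf => by simp [hf])
  have av6 := av wC6 (fun f hf => by simp [hf])
  unfold capC
  split_ifs with h1 h11 h4 h5 h2
  · -- C1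
    rw [recoverC, if_neg ((mem_reroute_iff wC1 na).not.2 (by rw [wC1_edges]; decide)),
      if_neg ((mem_reroute_iff wC1 nb).not.2 (by rw [wC1_edges]; decide)),
      if_pos ((mem_reroute_iff wC1 nc).2 (by rw [wC1_edges]; decide)),
      if_pos ((mem_reroute_iff wC1 nd).2 (by rw [wC1_edges]; decide))]
    exact reroute_undo wC1 h1 av1
  · -- C4
    rw [recoverC, if_pos ((mem_reroute_iff wC4 na).2 (by rw [wC4_edges]; decide))]
    exact reroute_undo wC4 h4 av4
  · -- C5
    have hum := nw_edge_C hE hC h0 h1 h4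
    rw [recoverC, if_neg ((mem_reroute₂_iff wC5 na).not.2 (by rw [wC5_edges]; decide)),
      if_neg ((mem_reroute₂_iff wC5 nb).not.2 (by rw [wC5_edges]; decide)),
      if_pos ((mem_reroute₂_iff wC5 nc).2 (by rw [wC5_edges]; decide)),
      if_neg ((mem_reroute₂_iff wC5 nd).not.2 (by rw [wC5_edges]; decide))]
    exact reroute₂_undo wC5 hum h5 av5
  · -- C6
    have h6 := ne_edge_C6 hE hC h11 h1 h5
    rw [recoverC, if_neg ((mem_reroute_iff wC6 na).not.2 (by rw [wC6_edges]; decide)),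
      if_pos ((mem_reroute_iff wC6 nb).2 (by rw [wC6_edges]; decide))]
    exact reroute_undo wC6 h6 av6
  · -- C2: here `(1,1) ∉ E`, so the two detour edges at `(1,1)` avoid `E` as well
    have av2 : ∀ f ∈ wC2.edges.toFinset, f ∉ E := by
      intro f hf
      rw [List.mem_toFinset, wC2_edges] at hf
      simp only [List.mem_cons, List.not_mem_nil, or_false] at hf
      rcases hf with rfl | rfl | rfl | rfl | rfl
      · exact not_mem_of_right h11
      · exact not_mem_of_left h11
      all_goals exact corridor_edge_not_mem hC (by decide)
    rw [recoverC, if_neg ((mem_reroute_iff wC2 na).not.2 (by rw [wC2_edges]; decide)),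
      if_neg ((mem_reroute_iff wC2 nb).not.2 (by rw [wC2_edges]; decide)),
      if_neg ((mem_reroute_iff wC2 nc).not.2 (by rw [wC2_edges]; decide)),
      if_pos ((mem_reroute_iff wC2 nf).2 (by rw [wC2_edges]; decide))]
    exact reroute_undo wC2 h2 av2
  · -- C3
    have h3 := sw_edge_C hE hC h0 h1 h2
    have av3 : ∀ f ∈ wC3.edges.toFinset, f ∉ E := by
      intro f hf
      rw [List.mem_toFinset, wC3_edges] at hf
      simp only [List.mem_cons, List.not_mem_nil, or_false] at hf
      rcases hf with rfl | rfl | rfl | rfl | rfl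
      · exact corridor_edge_not_mem hC (by decide)
      · exact corridor_edge_not_mem hC (by decide)
      · exact corridor_edge_not_mem hC (by decide)
      · exact not_mem_of_right h11
      · exact not_mem_of_left h11
    rw [recoverC, if_neg ((mem_reroute_iff wC3 na).not.2 (by rw [wC3_edges]; decide)),
      if_neg ((mem_reroute_iff wC3 nb).not.2 (by rw [wC3_edges]; decide)),
      if_neg ((mem_reroute_iff wC3 nc).not.2 (by rw [wC3_edges]; decide)),
      if_neg ((mem_reroute_iff wC3 nf).not.2 (by rw [wC3_edges]; decide))]
    exact reroute_undo wC3 h3 av3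

/-- **Type C: the rule is injective** on polygons satisfying the type-C hypothesis. [cite: Madras1995LatticeAnimalsExponent, §2 (the join is injective)] -/
theorem capC_injective {E₁ E₂ : Finset (Sym2 (Site 2))} (hC₁ : CorrC E₁) (hC₂ : CorrC E₂)
    (h0₁ : (![0, 0] : Site 2) ∈ vertsOf E₁) (h0₂ : (![0, 0] : Site 2) ∈ vertsOf E₂)
    (hE₁ : IsPolygon brickGraph E₁) (hE₂ : IsPolygon brickGraph E₂) (h : capC E₁ = capC E₂) : E₁ = E₂ := by
  rw [← recoverC_capC hE₁ hC₁ h0₁, ← recoverC_capC hE₂ hC₂ h0₂, h]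

end TypeC

/-! ### (6) Junction signatures — the capped polygon near its junction NE-edge tells the contact type apart

Relative to the junction site `p` of the left polygon (`p = (2,0)` for type A, `(1,0)` for type B, `juncC E` for type C, in the contact
frame), the decoder of S4𝕋 reads three edges: `p+(1,1) – p+(2,2)` (present iff type C with `juncC = (1,−1)`), `p – p+(−1,−1)` (absent iff
type C with `juncC = (3,−1)`), and `p+(−1,1) – p+(−3,1)` / `p+(−1,−1) – p+(−3,−1)` (one present iff type A).  Machine cross-check:
`g10/capsearch/runglobal.log` (0 ambiguous pictures among 116 724). -/
section Signatures

/-- membership in a one-edge reroute for an edge that is not in `E`: only the detour can contribute. [folklore] -/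
private theorem not_mem_reroute {e f : Sym2 (Site 2)} {u v : Site 2} (A : brickGraph.Walk u v) (hf : f ∉ E)
    (hA : f ∉ A.edges) : f ∉ E.erase e ∪ A.edges.toFinset := fun h => hA ((mem_reroute_iff A hf).1 h)

/-- membership in a two-edge reroute for an edge that is not in `E`. [folklore] -/
private theorem not_mem_reroute₂ {e e' f : Sym2 (Site 2)} {u v : Site 2} (A : brickGraph.Walk u v) (hf : f ∉ E)
    (hA : f ∉ A.edges) : f ∉ (E.erase e).erase e' ∪ A.edges.toFinset := fun h => hA ((mem_reroute₂_iff A hf).1 h)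

/-- **Type-A junction signature** (junction site `p = (2,0)`): `p+(1,1) – p+(2,2) = (3,1)–(4,2)` is NOT an edge of `capA E`,
`p – p+(−1,−1) = (2,0)–(1,−1)` IS, and one of `(−1,1)–(1,1)`, `(−1,−1)–(1,−1)` (i.e. `p+(−3,±1) – p+(−1,±1)`) IS.
[cite: Madras1995LatticeAnimalsExponent, §2 (the join is injective); Hammond2015SAPJoining, §4.1 p. 18 (arXiv v5)] -/
theorem sigA (hC : CorrA E) :
    s((![3, 1] : Site 2), ![4, 2]) ∉ capA E ∧ s((![1, -1] : Site 2), ![2, 0]) ∈ capA E ∧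
      (s((![-1, 1] : Site 2), ![1, 1]) ∈ capA E ∨ s((![-1, -1] : Site 2), ![1, -1]) ∈ capA E) := by
  classical
  have n31 : s((![3, 1] : Site 2), ![4, 2]) ∉ E := not_mem_of_left (newA_not_vert hC (Or.inr (Or.inl rfl)))
  refine ⟨?_, (ne_edges_capA E).2, ?_⟩
  · unfold capA
    split_ifs
    · exact not_mem_reroute wA1 n31 (by decide)
    · exact not_mem_reroute wA2 n31 (by decide)
  · unfold capA
    split_ifs
    · left; apply Finset.mem_union_right; rw [List.mem_toFinset]; decide
    · right; apply Finset.mem_union_right; rw [List.mem_toFinset]; decide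

/-- **Type-B junction signature** (junction site `p = (1,0)`): `(2,1)–(3,2)` is NOT an edge of `capB E`, `(0,−1)–(1,0)` IS, and
NEITHER `(−2,1)–(0,1)` nor `(−2,−1)–(0,−1)` is (`p+(−3,±1) – p+(−1,±1)`).
[cite: Madras1995LatticeAnimalsExponent, §2 (the join is injective); Hammond2015SAPJoining, §4.1 p. 18 (arXiv v5)] -/
theorem sigB (hC : CorrB E) :
    s((![2, 1] : Site 2), ![3, 2]) ∉ capB E ∧ s((![0, -1] : Site 2), ![1, 0]) ∈ capB E ∧
      s((![-2, 1] : Site 2), ![0, 1]) ∉ capB E ∧ s((![-2, -1] : Site 2), ![0, -1]) ∉ capB E := by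
  classical
  have n21 : s((![2, 1] : Site 2), ![3, 2]) ∉ E := not_mem_of_left (newB_not_vert hC (Or.inr (Or.inr (Or.inr rfl))))
  have n01 : s((![-2, -1] : Site 2), ![0, -1]) ∉ E := not_mem_of_right (newB_not_vert hC (Or.inr (Or.inl rfl)))
  refine ⟨?_, (ne_edges_capB E).2, ?_, ?_⟩
  · unfold capB
    split_ifs
    · exact not_mem_reroute wB1 n21 (by decide)
    · exact not_mem_reroute wB2 n21 (by decide)
  · unfold capB
    split_ifs with h
    · intro hm
      rcases Finset.mem_union.1 hm with hm | hm
      · exact (Finset.mem_erase.1 hm).1 rfl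
      · rw [List.mem_toFinset] at hm; revert hm; decide
    · exact not_mem_reroute wB2 h (by decide)
  · unfold capB
    split_ifs
    · exact not_mem_reroute wB1 n01 (by decide)
    · exact not_mem_reroute wB2 n01 (by decide)

/-- **Type-C junction signature** (junction site `p = juncC E ∈ {(1,−1), (3,−1)}`): `(4,0)–(5,1)` and `(2,−2)–(3,−1)` are NOT edges of
`capC E` (they are `p+(1,1) – p+(2,2)` and `p+(−1,−1) – p` for `p = (3,−1)`), and `(2,0)–(3,1)` (`= p+(1,1) – p+(2,2)` for `p = (1,−1)`) IS
an edge when `juncC E = (1,−1)`.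
[cite: Madras1995LatticeAnimalsExponent, §2 (the join is injective); Hammond2015SAPJoining, §4.1 p. 18 (arXiv v5)] -/
theorem sigC (hC : CorrC E) :
    s((![4, 0] : Site 2), ![5, 1]) ∉ capC E ∧ s((![2, -2] : Site 2), ![3, -1]) ∉ capC E ∧
      (juncC E = ![1, -1] → s((![2, 0] : Site 2), ![3, 1]) ∈ capC E) := by
  classical
  have n40 : s((![4, 0] : Site 2), ![5, 1]) ∉ E := corridor_edge_not_mem hC (Or.inl (by simp))
  have n31 : s((![2, -2] : Site 2), ![3, -1]) ∉ E := corridor_edge_not_mem hC (Or.inr (by simp))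
  refine ⟨?_, ?_, ?_⟩
  · unfold capC
    split_ifs
    · exact not_mem_reroute wC1 n40 (by rw [wC1_edges]; decide)
    · exact not_mem_reroute wC4 n40 (by rw [wC4_edges]; decide)
    · exact not_mem_reroute₂ wC5 n40 (by rw [wC5_edges]; decide)
    · exact not_mem_reroute wC6 n40 (by rw [wC6_edges]; decide)
    · exact not_mem_reroute wC2 n40 (by rw [wC2_edges]; decide)
    · exact not_mem_reroute wC3 n40 (by rw [wC3_edges]; decide)
  · unfold capC
    split_ifs
    · exact not_mem_reroute wC1 n31 (by rw [wC1_edges]; decide)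
    · exact not_mem_reroute wC4 n31 (by rw [wC4_edges]; decide)
    · exact not_mem_reroute₂ wC5 n31 (by rw [wC5_edges]; decide)
    · exact not_mem_reroute wC6 n31 (by rw [wC6_edges]; decide)
    · exact not_mem_reroute wC2 n31 (by rw [wC2_edges]; decide)
    · exact not_mem_reroute wC3 n31 (by rw [wC3_edges]; decide)
  · intro hj
    have hn : ¬ (s((![0, 0] : Site 2), ![1, 1]) ∈ E ∨ (![1, 1] : Site 2) ∈ vertsOf E) := by
      intro h
      rw [juncC, if_pos h] at hj
      exact absurd (congrFun hj 0) (by decide)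
    unfold capC
    rw [if_neg (fun h => hn (Or.inl h)), if_neg (fun h => hn (Or.inr h))]
    split_ifs
    · apply Finset.mem_union_right; rw [List.mem_toFinset, wC2_edges]; decide
    · apply Finset.mem_union_right; rw [List.mem_toFinset, wC3_edges]; decide

end Signatures

/-! ### (7) The junction-frame decoder: type and junction offset are legible from the capped left polygon

`L := capX E − j` (the capped polygon translated so that its junction site is the origin; `j = (2,0)`, `(1,0)`, `juncC E` for types A, B, C).
Two contact data with the same `L` have the same type and the same `j`; with `capX_injective` the polygon `E` itself is then recovered. -/
section Decoder

open Literature.Barriers.CriticalPhenomena.SupercriticalSAW (shiftEdges mem_shiftEdges_iff shiftEdges_injective)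

/-- a concrete edge in a translated edge set. [folklore] -/
private theorem mk_mem_shiftEdges_iff' {c : Site 2} {F : Finset (Sym2 (Site 2))} {a b : Site 2} :
    s(a, b) ∈ shiftEdges c F ↔ s(a - c, b - c) ∈ F := by
  constructor
  · intro h
    obtain ⟨e', he', hmap⟩ := mem_shiftEdges_iff.1 h
    induction e' using Sym2.ind with
    | _ x y =>
      simp only [Sym2.map_mk, Sym2.eq_iff] at hmap
      rcases hmap with ⟨rfl, rfl⟩ | ⟨rfl, rfl⟩
      · simpa using he'
      · rw [Sym2.eq_swap]; simpa using he'
  · intro h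
    exact mem_shiftEdges_iff.2 ⟨_, h, by simp [sub_add_cancel]⟩

/-- transport of one concrete edge through an equality of junction-frame pictures:
`s(a + c₁, b + c₁) ∈ F₁ ↔ s(a + c₂, b + c₂) ∈ F₂` when `F₁ − c₁ = F₂ − c₂`. [folklore] -/
private theorem mem_transport {c₁ c₂ : Site 2} {F₁ F₂ : Finset (Sym2 (Site 2))}
    (h : shiftEdges (-c₁) F₁ = shiftEdges (-c₂) F₂) (a b : Site 2) :
    s(a + c₁, b + c₁) ∈ F₁ ↔ s(a + c₂, b + c₂) ∈ F₂ := by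
  have h1 : s(a, b) ∈ shiftEdges (-c₁) F₁ ↔ s(a + c₁, b + c₁) ∈ F₁ := by
    rw [mk_mem_shiftEdges_iff', sub_neg_eq_add, sub_neg_eq_add]
  have h2 : s(a, b) ∈ shiftEdges (-c₂) F₂ ↔ s(a + c₂, b + c₂) ∈ F₂ := by
    rw [mk_mem_shiftEdges_iff', sub_neg_eq_add, sub_neg_eq_add]
  rw [← h1, ← h2, h]

/-- the two possible junction offsets of type C. [cite: Hammond2015SAPJoining, §4.1 p. 18 (arXiv v5)] -/
theorem juncC_cases' (F : Finset (Sym2 (Site 2))) : juncC F = ![1, -1] ∨ juncC F = ![3, -1] := by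
  unfold juncC
  split_ifs
  · exact Or.inr rfl
  · exact Or.inl rfl

/-- literal vector sums used by the decoder. [folklore] -/
private theorem v2_add (a b c d : ℤ) : (![a, b] : Site 2) + ![c, d] = ![a + c, b + d] := by
  funext i; fin_cases i <;> rfl

/-- **Decoder, A ≠ B**: a type-A junction picture is never a type-B junction picture.
[cite: Madras1995LatticeAnimalsExponent, §2 (the join is injective); Hammond2015SAPJoining, §4.1 p. 18 (arXiv v5)] -/
theorem capA_ne_capB {E₁ E₂ : Finset (Sym2 (Site 2))} (hC₁ : CorrA E₁) (hC₂ : CorrB E₂) :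
    shiftEdges (-![2, 0]) (capA E₁) ≠ shiftEdges (-![1, 0]) (capB E₂) := by
  intro h
  obtain ⟨-, -, a3⟩ := sigA hC₁
  obtain ⟨-, -, b3, b4⟩ := sigB hC₂
  rcases a3 with a3 | a3
  · have k := (mem_transport h ![-3, 1] ![-1, 1]).1 (by simpa only [v2_add, Int.reduceAdd] using a3)
    simp only [v2_add, Int.reduceAdd] at k
    exact b3 k
  · have k := (mem_transport h ![-3, -1] ![-1, -1]).1 (by simpa only [v2_add, Int.reduceAdd] using a3)
    simp only [v2_add, Int.reduceAdd] at k
    exact b4 k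

/-- **Decoder, A ≠ C**: a type-A junction picture is never a type-C junction picture.
[cite: Madras1995LatticeAnimalsExponent, §2 (the join is injective); Hammond2015SAPJoining, §4.1 p. 18 (arXiv v5)] -/
theorem capA_ne_capC {E₁ E₂ : Finset (Sym2 (Site 2))} (hC₁ : CorrA E₁) (hC₂ : CorrC E₂) :
    shiftEdges (-![2, 0]) (capA E₁) ≠ shiftEdges (-juncC E₂) (capC E₂) := by
  intro h
  obtain ⟨a1, a2, -⟩ := sigA hC₁
  obtain ⟨-, c2, c3⟩ := sigC hC₂
  rcases juncC_cases' E₂ with hj | hj <;> rw [hj] at h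
  · have k := (mem_transport h ![1, 1] ![2, 2]).2 (by simpa only [v2_add, Int.reduceAdd] using c3 hj)
    simp only [v2_add, Int.reduceAdd] at k
    exact a1 k
  · have k := (mem_transport h ![-1, -1] ![0, 0]).1 (by simpa only [v2_add, Int.reduceAdd] using a2)
    simp only [v2_add, Int.reduceAdd] at k
    exact c2 k

/-- **Decoder, B ≠ C**: a type-B junction picture is never a type-C junction picture.
[cite: Madras1995LatticeAnimalsExponent, §2 (the join is injective); Hammond2015SAPJoining, §4.1 p. 18 (arXiv v5)] -/
theorem capB_ne_capC {E₁ E₂ : Finset (Sym2 (Site 2))} (hC₁ : CorrB E₁) (hC₂ : CorrC E₂) :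
    shiftEdges (-![1, 0]) (capB E₁) ≠ shiftEdges (-juncC E₂) (capC E₂) := by
  intro h
  obtain ⟨b1, b2, -, -⟩ := sigB hC₁
  obtain ⟨-, c2, c3⟩ := sigC hC₂
  rcases juncC_cases' E₂ with hj | hj <;> rw [hj] at h
  · have k := (mem_transport h ![1, 1] ![2, 2]).2 (by simpa only [v2_add, Int.reduceAdd] using c3 hj)
    simp only [v2_add, Int.reduceAdd] at k
    exact b1 k
  · have k := (mem_transport h ![-1, -1] ![0, 0]).1 (by simpa only [v2_add, Int.reduceAdd] using b2)
    simp only [v2_add, Int.reduceAdd] at k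
    exact c2 k

/-- **Decoder, C/C**: equal type-C junction pictures have the same junction offset `juncC`.
[cite: Madras1995LatticeAnimalsExponent, §2 (the join is injective); Hammond2015SAPJoining, §4.1 p. 18 (arXiv v5)] -/
theorem juncC_eq_of_picture_eq {E₁ E₂ : Finset (Sym2 (Site 2))} (hC₁ : CorrC E₁) (hC₂ : CorrC E₂)
    (h : shiftEdges (-juncC E₁) (capC E₁) = shiftEdges (-juncC E₂) (capC E₂)) : juncC E₁ = juncC E₂ := by
  obtain ⟨c1, -, c3⟩ := sigC hC₁
  obtain ⟨c1', -, c3'⟩ := sigC hC₂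
  rcases juncC_cases' E₁ with hj | hj <;> rcases juncC_cases' E₂ with hj' | hj'
  · rw [hj, hj']
  · exfalso
    rw [hj, hj'] at h
    have k := (mem_transport h ![1, 1] ![2, 2]).1 (by simpa only [v2_add, Int.reduceAdd] using c3 hj)
    simp only [v2_add, Int.reduceAdd] at k
    exact c1' k
  · exfalso
    rw [hj, hj'] at h
    have k := (mem_transport h ![1, 1] ![2, 2]).2 (by simpa only [v2_add, Int.reduceAdd] using c3' hj')
    simp only [v2_add, Int.reduceAdd] at k
    exact c1 k
  · rw [hj, hj']

/-- **Decoder, same type**: equal junction pictures of the same type come from the same polygon (A).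
[cite: Madras1995LatticeAnimalsExponent, §2 (the join is injective)] -/
theorem eq_of_pictureA_eq {E₁ E₂ : Finset (Sym2 (Site 2))} (hC₁ : CorrA E₁) (hC₂ : CorrA E₂)
    (h0₁ : (![0, 0] : Site 2) ∈ vertsOf E₁) (h0₂ : (![0, 0] : Site 2) ∈ vertsOf E₂)
    (hE₁ : IsPolygon brickGraph E₁) (hE₂ : IsPolygon brickGraph E₂)
    (h : shiftEdges (-![2, 0]) (capA E₁) = shiftEdges (-![2, 0]) (capA E₂)) : E₁ = E₂ :=
  capA_injective hC₁ hC₂ h0₁ h0₂ hE₁ hE₂ (shiftEdges_injective _ h)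

/-- **Decoder, same type** (B). [cite: Madras1995LatticeAnimalsExponent, §2 (the join is injective)] -/
theorem eq_of_pictureB_eq {E₁ E₂ : Finset (Sym2 (Site 2))} (hC₁ : CorrB E₁) (hC₂ : CorrB E₂)
    (ht₁ : (![0, 1] : Site 2) ∈ vertsOf E₁) (ht₂ : (![0, 1] : Site 2) ∈ vertsOf E₂)
    (hE₁ : IsPolygon brickGraph E₁) (hE₂ : IsPolygon brickGraph E₂)
    (h : shiftEdges (-![1, 0]) (capB E₁) = shiftEdges (-![1, 0]) (capB E₂)) : E₁ = E₂ :=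
  capB_injective hC₁ hC₂ ht₁ ht₂ hE₁ hE₂ (shiftEdges_injective _ h)

/-- **Decoder, same type** (C; the junction offset is decoded first). [cite: Madras1995LatticeAnimalsExponent, §2 (the join is injective)] -/
theorem eq_of_pictureC_eq {E₁ E₂ : Finset (Sym2 (Site 2))} (hC₁ : CorrC E₁) (hC₂ : CorrC E₂)
    (h0₁ : (![0, 0] : Site 2) ∈ vertsOf E₁) (h0₂ : (![0, 0] : Site 2) ∈ vertsOf E₂)
    (hE₁ : IsPolygon brickGraph E₁) (hE₂ : IsPolygon brickGraph E₂)
    (h : shiftEdges (-juncC E₁) (capC E₁) = shiftEdges (-juncC E₂) (capC E₂)) : E₁ = E₂ := by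
  have hj := juncC_eq_of_picture_eq hC₁ hC₂ h
  rw [hj] at h
  exact capC_injective hC₁ hC₂ h0₁ h0₂ hE₁ hE₂ (shiftEdges_injective _ h)

end Decoder

end TriCap

end Literature.Probability.RandomPlanarGeometry.SAW
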